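import Literature.NumberTheory.Sieve.FGKMT2018BadPrimes
import Literature.NumberTheory.Sieve.FGKMT2018SievedCount
import Literature.NumberTheory.Sieve.FGKMT2018Corollary3Proof
import HarnessLib

/-!
# Ford–Green–Konyagin–Maynard–Tao 2018, §6: Theorem 4 (Random construction) from Theorem 5
# (Existence of good sieve weight) — PROVED

Topic `Literature/NumberTheory/Sieve`. Source: K. Ford, B. Green, S. Konyagin, J. Maynard, T. Tao,
*Long gaps between primes*, J. Amer. Math. Soc. 31 (2018) 65–105 = arXiv:1412.5029
[FordGreenKonyaginMaynardTao2018], §6 «Using a sieve weight», pp. 17–19: the deduction of Theorem 4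
from Theorem 5 (displays (6.7)–(6.17), Lemmas 6.1–6.3, Corollary 4).

This file PROVES the edge `Theorem 5 ⟹ Theorem 4` of the paper's chain
`Theorem 1 ⇐ Theorem 2 ⇐ {Corollary 3, Theorem 4} ⇐ {Theorem 3, Theorem 5}`, in the typed forms
`FordGreenKonyaginMaynardTao2018_theorem5 → FordGreenKonyaginMaynardTao2018_theorem4` of
`FGKMT2018RandomConstruction`, by wiring the §6 engines already in the tree:
the conditional law `ν_p` of `n_p` given `a⃗` and its sparsity (`FGKMT2018ConditionalLaw`), the first
and second moments of `Y_q(a⃗)` over the box of residue vectors (`FGKMT2018CoveringMoments`, Lemma 6.2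
and (6.15)–(6.17)), the bad primes `𝒫 ∖ 𝒫(a⃗)` (`FGKMT2018GoodPrimes`, `FGKMT2018BadPrimes`, Lemma 6.3),
the size of `𝒬 ∩ S(a⃗)` (`FGKMT2018SievedCount`, Corollary 4), the three-event Markov selection of a good
`a⃗` and the covering-sum estimate (`FGKMT2018AssemblyKit`), and the growth regime of the parameters
`r = ⌊log^{1/5} x⌋`, `σ`, `y`, `|𝒬|` (`FGKMT2018Theorem4Params`, `FGKMT2018AdmissibleShifts`,
`FGKMT2018SigmaBounds`).

PROOF OUTLINE (paper, pp. 17–19, with the constants made explicit). Fix `0 < c ≤ 1`; apply Theorem 5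
with `K' = 1`, `ε = 1/100` to the admissible tuple `H = {2j² : j ≤ r}`, `r = ⌊log^{1/5} x⌋`
(`FGKMT2018AdmissibleShifts`), obtaining `τ ≥ x^{-1/100}` and the weight `w`; let `ñ_p` have the law
`λ_p = w(p,·)/Σ_n w(p,n)` on the window `N = [-⌊y⌋, ⌊y⌋]`. With `X₀ = σ^r`, `η = 1/log³ x` the good primes
`𝒫(a⃗)` and `Z_p, X_p` are as in (6.10)–(6.12) and `ν_p` is the conditional law (`condLaw`). Three bad
events for the uniform residue vector `a⃗ ∈ ∏_{s ∈ 𝒮} ℤ/sℤ` are controlled by Markov's inequality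
(`exists_good_of_markov3`): (B1) `#(𝒬 ∩ S(a⃗)) ≥ 100 c x log₂ x/log x`, probability `≤ 0.82`
(`boxExp_card_sievedQ_le`); (B2) `Σ_{q ∈ 𝒬 ∩ S(a⃗)} (Y_q − σ^{r-1} m)² ≥ t₂ := σ^{2r} x/(32 log x log₂⁵ x)`,
`m = u x/(2y)`, probability `≤ 1/100` (`boxExp_sum_sq_dev_le`, (6.16)–(6.17)); (B3)
`Σ_{p ∉ 𝒫(a⃗)} X_p(a⃗) ≥ t₃ := 40 (|𝒫| + 1) σ^r/log³ x`, probability `≤ 1/20` (`boxExp_badPrimes_Xp_le`,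
Lemma 6.3). On a good `a⃗`: (4.27)′ is `¬`(B1); sparsity (4.26) is (6.7) via `probInEdge_condLaw_le`;
the exceptional set of (4.28) is `E₂ ∪ E₃` with `E₂ = {q : |Y_q − σ^{r−1} m| ≥ σ^r/(4 log₂² x)}`
(`#E₂ ≤ ¬(B2)-sum/κ₀² ≤ x/(2 log x log₂ x)`, `card_bad_le`) and
`E₃ = {q : Σ_h Σ_{p ∉ 𝒫(a⃗)} Z_p(a⃗; q − hp) ≥ σ^r/(4 log₂² x)}` (`#E₃ ≤ 160 r (|𝒫|+1) log₂² x/log³ x`,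
`sum_Zp_badPrimes_le`); for the other `q ∈ 𝒬 ∩ S(a⃗)`, `covering_sum_estimate` gives
`Σ_p P(q ∈ e_p(a⃗)) = C + O_≤(1/log₂² x)` with `C = m/σ = u x/(2σ y) ∈ [u₁/(2000 c), u₂/(700 c)]`
by (6.9) `σ y = (1 + O_≤(1/100)) 80 c x log₂ x` and `u ≍ log r ≍ log₂ x`.

## Main statements
* `fgkmt2018_theorem4_of_theorem5` — **Theorem 5 ⟹ Theorem 4**
  [cite: FordGreenKonyaginMaynardTao2018, §6 pp. 17–19].
* `fgkmt2018_theorem2_of_theorem3_theorem5`, `fgkmt2018_theorem1_of_theorem3_theorem5`,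
  `rankinConstant_of_fgkmt2018_theorem3_theorem5` — the chain down to Theorem 1 and every Rankin
  constant from the two remaining named inputs, Theorem 3 (covering) and Theorem 5 (sieve weight)
  [cite: FordGreenKonyaginMaynardTao2018, §§3–6].
-/

noncomputable section

open Finset Filter

namespace Literature.NumberTheory.Sieve

namespace FGKMT2018

/-! ### §0 Small helpers -/

/-- `log^[2] t = log log t`. [folklore] -/
private theorem thm4_iter_two (t : ℝ) : Real.log^[2] t = Real.log (Real.log t) := by
  simp [Function.iterate_succ_apply']

/-- `log x ≥ 1 ⟹ x > 1` (for natural `x`). [folklore] -/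
private theorem thm4_one_lt_of_log {x : ℕ} (h : 1 ≤ Real.log x) : (1 : ℝ) < x := by
  by_contra hx
  have := Real.log_nonpos (Nat.cast_nonneg x) (not_lt.1 hx)
  linarith

/-- `|n| ≤ y ⟹ n ∈ [-⌊y⌋, ⌊y⌋]`: the support clause of Theorem 5 places the weight inside the window.
[cite: FordGreenKonyaginMaynardTao2018, Thm 5 p. 17] -/
theorem thm4_mem_weightWindow_of_abs_le {c : ℝ} {x : ℕ} {n : ℤ} (hy : 0 ≤ ySieve c x)
    (hn : |(n : ℝ)| ≤ ySieve c x) : n ∈ weightWindow c x := by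
  unfold weightWindow
  rw [Finset.mem_Icc]
  have h1 : |n| ≤ ⌊ySieve c x⌋ := Int.le_floor.2 (by push_cast; exact hn)
  have h2 : (⌊ySieve c x⌋₊ : ℤ) = ⌊ySieve c x⌋ := by
    rw [← Int.floor_toNat, Int.toNat_of_nonneg (Int.floor_nonneg.2 hy)]
  rw [h2]
  exact abs_le.1 h1

/-- The weight of Theorem 5 vanishes off the window `[-⌊y⌋, ⌊y⌋]`.
[cite: FordGreenKonyaginMaynardTao2018, Thm 5 p. 17] -/
theorem thm4_weight_eq_zero_off_window {c : ℝ} {x : ℕ} {w : ℕ → ℤ → ℝ} (hy : 0 ≤ ySieve c x)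
    (hsupp : ∀ p n, w p n ≠ 0 → p ∈ primesHalf x ∧ |(n : ℝ)| ≤ ySieve c x) :
    ∀ p n, n ∉ weightWindow c x → w p n = 0 := by
  intro p n hn
  by_contra h
  exact hn (thm4_mem_weightWindow_of_abs_le hy (hsupp p n h).2)

/-! ### §1 Elementary inequalities -/

/-- Second-moment bracket of (6.16)–(6.17):
`(1+ε)²/(1−δ) − 2(1−ε)E + 1 ≤ 5ε + 4δ + 2a` for `E ≥ 1 − a`, `ε ≤ 1/3`, `δ ≤ 1/2`.
[cite: FordGreenKonyaginMaynardTao2018, (6.17) p. 19] -/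
theorem thm4_bracket_sq {ε δ E a : ℝ} (hε0 : 0 ≤ ε) (hε : ε ≤ 1 / 3) (hδ0 : 0 ≤ δ)
    (hδ : δ ≤ 1 / 2) (ha : 0 ≤ a) (hE : 1 - a ≤ E) :
    (1 + ε) ^ 2 / (1 - δ) - 2 * (1 - ε) * E + 1 ≤ 5 * ε + 4 * δ + 2 * a := by
  have h1 : (1 + ε) ^ 2 / (1 - δ) ≤ 1 + 3 * ε + 4 * δ := by
    rw [div_le_iff₀ (by linarith)]
    nlinarith [mul_nonneg hε0 (by linarith : (0 : ℝ) ≤ 1 - ε),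
      mul_nonneg hδ0 (by linarith : (0 : ℝ) ≤ 3 - 3 * ε - 4 * δ)]
  have h2 : 2 * (1 - ε) * (1 - a) ≤ 2 * (1 - ε) * E :=
    mul_le_mul_of_nonneg_left hE (by linarith)
  nlinarith [mul_nonneg hε0 ha]

/-- Bad-primes bracket of Lemma 6.3: `σ/(1−δ) − (1−η)σ(1−β) ≤ σ(2δ + η + β)`.
[cite: FordGreenKonyaginMaynardTao2018, Lemma 6.3 p. 18] -/
theorem thm4_bracket_bad {σr δ η β : ℝ} (hσ : 0 ≤ σr) (hδ0 : 0 ≤ δ) (hδ : δ ≤ 1 / 2)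
    (hη0 : 0 ≤ η) (hβ : 0 ≤ β) :
    σr / (1 - δ) - (1 - η) * σr * (1 - β) ≤ σr * (2 * δ + η + β) := by
  have h1 : σr / (1 - δ) ≤ σr * (1 + 2 * δ) := by
    rw [div_le_iff₀ (by linarith)]
    nlinarith [mul_nonneg hσ (mul_nonneg hδ0 (by linarith : (0 : ℝ) ≤ 1 - 2 * δ))]
  nlinarith [mul_nonneg hσ (mul_nonneg hη0 hβ)]

/-- `1/(1−δ) ≤ 1 + 2δ` for `0 ≤ δ ≤ 1/2`. [folklore] -/
private theorem thm4_one_div_one_sub_le {δ : ℝ} (hδ0 : 0 ≤ δ) (hδ : δ ≤ 1 / 2) :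
    1 / (1 - δ) ≤ 1 + 2 * δ := by
  rw [div_le_iff₀ (by linarith)]
  nlinarith [mul_nonneg hδ0 (by linarith : (0 : ℝ) ≤ 1 - 2 * δ)]

/-! ### §2 Growth: `log^{20} x · x^{-2/3+3/100} ≤ x^{-3/5}` -/

/-- `log^{20} x · x^{-2/3 + 3/100} ≤ x^{-1/2 - 1/10}` for large `x` (the room in (6.7):
`P(ñ_p = n) ≪ x^{-1/2-1/6+o(1)}` against the target `x^{-1/2-1/10}` of (4.26)).
[cite: FordGreenKonyaginMaynardTao2018, (6.7) p. 17] -/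
theorem thm4_rpow_growth : ∀ᶠ x : ℕ in atTop,
    (Real.log x) ^ 20 * (x : ℝ) ^ (-(2 / 3 : ℝ) + 3 / 100) ≤ (x : ℝ) ^ (-(3 / 5 : ℝ)) := by
  filter_upwards [params_growth] with x hg
  obtain ⟨h1, -, -, h81, -, -, -, h7⟩ := hg
  have hL0 : 0 < Real.log x := by linarith
  have hx0 : (0 : ℝ) < x := by linarith [thm4_one_lt_of_log (show (1 : ℝ) ≤ Real.log x by linarith)]
  have hsplit : (x : ℝ) ^ (-(3 / 5 : ℝ)) =
      (x : ℝ) ^ ((11 : ℝ) / 300) * (x : ℝ) ^ (-(2 / 3 : ℝ) + 3 / 100) := by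
    rw [← Real.rpow_add hx0]; norm_num
  rw [hsplit]
  refine mul_le_mul_of_nonneg_right ?_ (Real.rpow_nonneg hx0.le _)
  rw [← Real.exp_log (pow_pos hL0 20), Real.log_pow, Real.rpow_def_of_pos hx0]
  refine Real.exp_le_exp.2 ?_
  push_cast
  nlinarith [mul_nonneg (by linarith : (0 : ℝ) ≤ Real.log (Real.log x) - 7)
    (by linarith : (0 : ℝ) ≤ Real.log (Real.log x))]

/-! ### §3 The numerical budgets (pure real inequalities) -/

/-- **(6.7): the sparsity budget `W/T ≤ 2 σ^r x^{-2/3+3/100}`.** With `W = x^{1/3+1/100}` (6.6),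
`T = (1 − ε₁) τ y/log^r x` (lower half of (6.3)), `τ ≥ x^{-1/100}` (6.2), `y ≥ x` and
`(log x/σ)^r ≤ x^{1/100}`: `P(ñ_p = n) ≤ W/T ≤ 2 σ^r x^{-2/3+3/100}`. Here `x₁ = x^{1/100}`,
`ρ = x^{-2/3+3/100}`, `Lr = log^r x`, and the exponent bookkeeping is the identity `W x₁ x₁ = ρ x`.
[cite: FordGreenKonyaginMaynardTao2018, (6.7) p. 17] -/
theorem thm4_WT_le {X x₁ W ρ T Lr σr τ y ε₁ : ℝ} (hX : 0 < X) (hx₁ : 0 < x₁) (hLr : 0 < Lr)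
    (hσr : 0 < σr) (hτ : x₁⁻¹ ≤ τ) (hy : X ≤ y) (hε₁ : ε₁ ≤ 1 / 2)
    (hT : T = (1 - ε₁) * (τ * y / Lr)) (hW0 : 0 ≤ W) (hWx : W * x₁ * x₁ = ρ * X)
    (hLσ : Lr ≤ x₁ * σr) : 0 < T ∧ W / T ≤ 2 * σr * ρ := by
  have hτ0 : 0 < τ := lt_of_lt_of_le (inv_pos.2 hx₁) hτ
  have hy0 : 0 < y := lt_of_lt_of_le hX hy
  have hT1 : x₁⁻¹ * X / (2 * Lr) ≤ T := by
    rw [hT, div_le_iff₀ (by positivity)]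
    have h1 : x₁⁻¹ * X ≤ τ * y := mul_le_mul hτ hy hX.le hτ0.le
    have h2 : 0 ≤ τ * y / Lr := by positivity
    calc x₁⁻¹ * X ≤ τ * y := h1
      _ = 1 * (τ * y / Lr) * Lr := by field_simp
      _ ≤ (2 * (1 - ε₁)) * (τ * y / Lr) * Lr :=
          mul_le_mul_of_nonneg_right (mul_le_mul_of_nonneg_right (by linarith) h2) hLr.le
      _ = (1 - ε₁) * (τ * y / Lr) * (2 * Lr) := by ring
  have hT0' : 0 < x₁⁻¹ * X / (2 * Lr) := by positivity
  have hT0 : 0 < T := lt_of_lt_of_le hT0' hT1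
  refine ⟨hT0, ?_⟩
  calc W / T ≤ W / (x₁⁻¹ * X / (2 * Lr)) := div_le_div_of_nonneg_left hW0 hT0' hT1
    _ = 2 * W * x₁ * Lr / X := by field_simp
    _ ≤ 2 * W * x₁ * (x₁ * σr) / X :=
        div_le_div_of_nonneg_right (mul_le_mul_of_nonneg_left hLσ (by positivity)) hX.le
    _ = 2 * σr * (W * x₁ * x₁) / X := by ring
    _ = 2 * σr * ρ := by rw [hWx]; field_simp

/-- **(4.26) from (6.7)**: `r (W/T)/((1 − η) σ^r) ≤ 4 r x^{-2/3+3/100} ≤ log^{20} x · x^{-2/3+3/100}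
≤ x^{-3/5}`. [cite: FordGreenKonyaginMaynardTao2018, (6.7) ⟹ (4.26), p. 18] -/
theorem thm4_sparsity_num {rr Λ η σr ρ L G : ℝ} (hΛ0 : 0 ≤ Λ) (hΛ : Λ ≤ 2 * σr * ρ)
    (hσr : 0 < σr) (hη : η ≤ 1 / 2) (hr : rr ≤ L) (hL : 2 ≤ L)
    (hρ : 0 ≤ ρ) (hG : L ^ 20 * ρ ≤ G) : rr * Λ / ((1 - η) * σr) ≤ G := by
  have h4 : 4 * L ≤ L ^ 20 := by
    calc 4 * L ≤ 2 ^ 19 * L := by nlinarith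
      _ ≤ L ^ 19 * L :=
          mul_le_mul_of_nonneg_right (pow_le_pow_left₀ (by norm_num) hL 19) (by linarith)
      _ = L ^ 20 := by ring
  have hpos : 0 < (1 - η) * σr := mul_pos (by linarith) hσr
  have hσρ : 0 ≤ σr * ρ := mul_nonneg hσr.le hρ
  rw [div_le_iff₀ hpos]
  calc rr * Λ ≤ L * (2 * σr * ρ) := by nlinarith
    _ = (4 * L * ρ) * (σr / 2) := by ring
    _ ≤ (L ^ 20 * ρ) * ((1 - η) * σr) := by
        refine mul_le_mul (mul_le_mul_of_nonneg_right h4 hρ) (by nlinarith) (by positivity)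
          (by positivity)
    _ ≤ G * ((1 - η) * σr) := mul_le_mul_of_nonneg_right hG hpos.le

/-- **The second-moment budget (bad event B2).** From (6.16)–(6.17) in the form
`E Σ_q 1_{q ∈ S(a⃗)}(Y_q − σ^{r−1}m)² ≤ |𝒬|(σ^{2r−1} m² γ₀ + σ^r rΛ(1+ε)m/(1−δ₂))` with
`γ₀ ≤ 15 ε₁ + 16/log^{18} x`, `|𝒬| ≤ 1.01 y/log x`, `m = u x/(2y)`, `u ≤ u₂ log₂ x/5`,
`σ y ≥ 0.99 · 80 c x log₂ x` (6.9) and `Λ ≤ 2σ^r x^{-2/3+3/100}`: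
`E(…) ≤ t₂/100`, `t₂ = σ^{2r} x/(32 log x log₂⁵ x)`, once `log₂⁴ x ≥ 30 K u₂²/c`,
`log x ≥ 32 u₂²/c` and `log x ≥ 3879 u₂`.
[cite: FordGreenKonyaginMaynardTao2018, (6.16)–(6.17) p. 19] -/
theorem thm4_EF2_num {EF nQ σ m ε₁ δ₂ Ee Λ ρ K L L₂ c u₂ ur y X : ℝ} {r : ℕ}
    (hEF : EF ≤ nQ * (σ ^ (2 * r - 1) * m ^ 2 *
        ((1 + 3 * ε₁) ^ 2 / (1 - δ₂) - 2 * (1 - 3 * ε₁) * Ee + 1) +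
        σ ^ r * (r * Λ) * ((1 + 3 * ε₁) * m) / (1 - δ₂)))
    (hr : 1 ≤ r) (hrL : (r : ℝ) ≤ L) (hσ : 0 < σ) (hm : m = ur * X / (2 * y))
    (hur0 : 0 ≤ ur) (hur : ur ≤ u₂ * L₂ / 5) (hu₂ : 0 ≤ u₂)
    (hε₁0 : 0 ≤ ε₁) (hε₁ : ε₁ ≤ 1 / 100) (hε₁K : ε₁ * L₂ ^ 10 = K)
    (hδ0 : 0 ≤ δ₂) (hδ : δ₂ ≤ 2 / L ^ 18) (hEe : 1 - 4 / L ^ 19 ≤ Ee)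
    (hΛ : Λ ≤ 2 * σ ^ r * ρ) (hρ : 0 ≤ ρ) (hG : L ^ 20 * ρ ≤ 1)
    (hnQ0 : 0 ≤ nQ) (hnQ : nQ ≤ 101 / 100 * y / L) (hy : 0 < y) (hX : 0 < X) (hc : 0 < c)
    (hσy : 99 / 100 * (80 * c * X * L₂) ≤ σ * y)
    (hL : 2 ≤ L) (hL₂ : 1 ≤ L₂) (hL₂L : L₂ ≤ L)
    (hB2a : 30 * K * u₂ ^ 2 / c ≤ L₂ ^ 4) (hB2b : 32 * u₂ ^ 2 / c ≤ L) (hB2c : 3879 * u₂ ≤ L) :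
    EF ≤ σ ^ (2 * r) * X / (32 * L * L₂ ^ 5) / 100 := by
  have hL0 : 0 < L := by linarith
  have hL1 : 1 ≤ L := by linarith
  have hL₂0 : 0 < L₂ := by linarith
  have hm0 : 0 ≤ m := by rw [hm]; positivity
  have hσr : 0 < σ ^ r := pow_pos hσ r
  have hpow : σ ^ (2 * r - 1) * σ = σ ^ (2 * r) := by
    rw [← pow_succ]; congr 1; omega
  have hσ2r : σ ^ r * σ ^ r = σ ^ (2 * r) := by rw [two_mul, pow_add]
  have hL18 : (4 : ℝ) ≤ L ^ 18 := le_trans (by norm_num) (pow_le_pow_left₀ (by norm_num) hL 18)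
  -- reciprocal atoms
  obtain ⟨a18, ha18⟩ : ∃ t : ℝ, t = 1 / L ^ 18 := ⟨_, rfl⟩
  obtain ⟨a19, ha19⟩ : ∃ t : ℝ, t = 1 / L ^ 19 := ⟨_, rfl⟩
  have ha18pos : 0 ≤ a18 := by rw [ha18]; positivity
  have ha19pos : 0 ≤ a19 := by rw [ha19]; positivity
  have ha1918 : a19 ≤ a18 := by
    rw [ha18, ha19]
    exact div_le_div_of_nonneg_left (by norm_num) (by positivity)
      (pow_le_pow_right₀ hL1 (by norm_num))
  have ha18le : a18 ≤ 1 / 4 := by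
    rw [ha18]; exact div_le_div_of_nonneg_left (by norm_num) (by norm_num) hL18
  have hδ' : δ₂ ≤ 2 * a18 := by rw [ha18, ← div_eq_mul_one_div]; exact hδ
  have hEe' : 1 - 4 * a19 ≤ Ee := by rw [ha19, ← div_eq_mul_one_div]; exact hEe
  have hδhalf : δ₂ ≤ 1 / 2 := by linarith
  -- the bracket `γ₀ ≤ γ := 15 ε₁ + 16 a18`
  obtain ⟨γ, hγ⟩ : ∃ γ : ℝ, γ = 15 * ε₁ + 16 * a18 := ⟨_, rfl⟩
  have hγ0 : 0 ≤ γ := by rw [hγ]; positivity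
  have hγ₀ : (1 + 3 * ε₁) ^ 2 / (1 - δ₂) - 2 * (1 - 3 * ε₁) * Ee + 1 ≤ γ := by
    have h := thm4_bracket_sq (ε := 3 * ε₁) (by positivity) (by linarith) hδ0 hδhalf
      (by positivity : (0 : ℝ) ≤ 4 * a19) hEe'
    rw [hγ]; linarith
  have hfrac : (1 + 3 * ε₁) / (1 - δ₂) ≤ 3 := by
    rw [div_le_iff₀ (by linarith)]; linarith
  -- key inequality 1: `1616 log₂⁵x γ u² x ≤ σ y`
  have hkey1 : 1616 * L₂ ^ 5 * γ * ur ^ 2 * X ≤ σ * y := by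
    have hur2 : ur ^ 2 ≤ (u₂ * L₂ / 5) ^ 2 := pow_le_pow_left₀ hur0 hur 2
    have hA : 30 * ε₁ * u₂ ^ 2 * L₂ ^ 6 ≤ c := by
      have h1 : 30 * K * u₂ ^ 2 ≤ c * L₂ ^ 4 := by
        have := (div_le_iff₀ hc).1 hB2a; linarith
      rw [← hε₁K] at h1
      have h2 : 30 * ε₁ * u₂ ^ 2 * L₂ ^ 6 * L₂ ^ 4 ≤ c * L₂ ^ 4 := by
        calc 30 * ε₁ * u₂ ^ 2 * L₂ ^ 6 * L₂ ^ 4 = 30 * (ε₁ * L₂ ^ 10) * u₂ ^ 2 := by ring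
          _ ≤ c * L₂ ^ 4 := h1
      exact le_of_mul_le_mul_right h2 (by positivity)
    have hB : 32 * u₂ ^ 2 * L₂ ^ 6 * a18 ≤ c := by
      have h1 : 32 * u₂ ^ 2 ≤ c * L := by
        have := (div_le_iff₀ hc).1 hB2b; linarith
      have h2 : L₂ ^ 6 ≤ L ^ 6 := pow_le_pow_left₀ hL₂0.le hL₂L 6
      have h3 : L * L ^ 6 ≤ L ^ 18 := by
        rw [← pow_succ']
        exact pow_le_pow_right₀ hL1 (by norm_num)
      have h4 : 32 * u₂ ^ 2 * L₂ ^ 6 ≤ c * L ^ 18 :=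
        calc 32 * u₂ ^ 2 * L₂ ^ 6 ≤ (c * L) * L ^ 6 :=
              mul_le_mul h1 h2 (by positivity) (by positivity)
          _ = c * (L * L ^ 6) := by ring
          _ ≤ c * L ^ 18 := mul_le_mul_of_nonneg_left h3 hc.le
      rw [ha18, ← div_eq_mul_one_div, div_le_iff₀ (by positivity)]
      exact h4
    have hγc : u₂ ^ 2 * L₂ ^ 6 * γ ≤ c := by
      rw [hγ]
      have e : u₂ ^ 2 * L₂ ^ 6 * (15 * ε₁ + 16 * a18) =
          (30 * ε₁ * u₂ ^ 2 * L₂ ^ 6) / 2 + (32 * u₂ ^ 2 * L₂ ^ 6 * a18) / 2 := by ring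
      rw [e]; linarith
    have hcXL : 0 < c * X * L₂ := by positivity
    calc 1616 * L₂ ^ 5 * γ * ur ^ 2 * X ≤ 1616 * L₂ ^ 5 * γ * (u₂ * L₂ / 5) ^ 2 * X :=
          mul_le_mul_of_nonneg_right (mul_le_mul_of_nonneg_left hur2 (by positivity)) hX.le
      _ = 1616 / 25 * (L₂ * X) * (u₂ ^ 2 * L₂ ^ 6 * γ) := by ring
      _ ≤ 1616 / 25 * (L₂ * X) * c := mul_le_mul_of_nonneg_left hγc (by positivity)
      _ ≤ 99 / 100 * (80 * c * X * L₂) := by linarith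
      _ ≤ σ * y := hσy
  -- key inequality 2: `19392 log₂⁵x r ρ u ≤ 1`
  have hkey2 : 19392 * L₂ ^ 5 * r * ρ * ur ≤ 1 := by
    have hL7 : L ^ 7 * ρ ≤ 1 / L := by
      rw [le_div_iff₀ hL0]
      calc L ^ 7 * ρ * L = L ^ 8 * ρ := by ring
        _ ≤ L ^ 20 * ρ := mul_le_mul_of_nonneg_right (pow_le_pow_right₀ hL1 (by norm_num)) hρ
        _ ≤ 1 := hG
    have hurL : ur ≤ u₂ * L / 5 :=
      hur.trans (div_le_div_of_nonneg_right (mul_le_mul_of_nonneg_left hL₂L hu₂) (by norm_num))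
    have hL₂5 : L₂ ^ 5 ≤ L ^ 5 := pow_le_pow_left₀ hL₂0.le hL₂L 5
    calc 19392 * L₂ ^ 5 * r * ρ * ur ≤ 19392 * L ^ 5 * L * ρ * (u₂ * L / 5) := by
          have h1 : 19392 * L₂ ^ 5 * r ≤ 19392 * L ^ 5 * L :=
            mul_le_mul (mul_le_mul_of_nonneg_left hL₂5 (by norm_num)) hrL (Nat.cast_nonneg _)
              (by positivity)
          have h2 : 19392 * L₂ ^ 5 * r * ρ ≤ 19392 * L ^ 5 * L * ρ :=
            mul_le_mul_of_nonneg_right h1 hρ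
          exact mul_le_mul h2 hurL hur0 (by positivity)
      _ = 19392 / 5 * u₂ * (L ^ 7 * ρ) := by ring
      _ ≤ 19392 / 5 * u₂ * (1 / L) := mul_le_mul_of_nonneg_left hL7 (by positivity)
      _ ≤ 1 := by
          rw [mul_one_div, div_le_one hL0]; linarith
  -- the two terms
  have hT1 : nQ * (σ ^ (2 * r - 1) * m ^ 2 *
        ((1 + 3 * ε₁) ^ 2 / (1 - δ₂) - 2 * (1 - 3 * ε₁) * Ee + 1)) ≤
      σ ^ (2 * r) * X / (32 * L * L₂ ^ 5) / 200 := by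
    calc nQ * (σ ^ (2 * r - 1) * m ^ 2 *
          ((1 + 3 * ε₁) ^ 2 / (1 - δ₂) - 2 * (1 - 3 * ε₁) * Ee + 1))
        ≤ nQ * (σ ^ (2 * r - 1) * m ^ 2 * γ) :=
          mul_le_mul_of_nonneg_left (mul_le_mul_of_nonneg_left hγ₀ (by positivity)) hnQ0
      _ ≤ (101 / 100 * y / L) * (σ ^ (2 * r - 1) * m ^ 2 * γ) :=
          mul_le_mul_of_nonneg_right hnQ (by positivity)
      _ = σ ^ (2 * r - 1) * (101 / 400 * γ * ur ^ 2 * X ^ 2 / (L * y)) := by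
          rw [hm]; field_simp; ring
      _ ≤ σ ^ (2 * r - 1) * (σ * X / (6400 * L * L₂ ^ 5)) := by
          refine mul_le_mul_of_nonneg_left ?_ (by positivity)
          rw [div_le_div_iff₀ (by positivity) (by positivity)]
          have := mul_le_mul_of_nonneg_left hkey1 (by positivity : (0 : ℝ) ≤ 4 * X * L)
          linarith
      _ = σ ^ (2 * r) * X / (32 * L * L₂ ^ 5) / 200 := by
          rw [← hpow]; field_simp; ring
  have hT2 : nQ * (σ ^ r * (r * Λ) * ((1 + 3 * ε₁) * m) / (1 - δ₂)) ≤
      σ ^ (2 * r) * X / (32 * L * L₂ ^ 5) / 200 := by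
    have e : σ ^ r * (r * Λ) * ((1 + 3 * ε₁) * m) / (1 - δ₂) =
        σ ^ r * (r * Λ) * m * ((1 + 3 * ε₁) / (1 - δ₂)) := by ring
    calc nQ * (σ ^ r * (r * Λ) * ((1 + 3 * ε₁) * m) / (1 - δ₂))
        = nQ * (σ ^ r * (r * Λ) * m * ((1 + 3 * ε₁) / (1 - δ₂))) := by rw [e]
      _ ≤ nQ * (σ ^ r * (r * (2 * σ ^ r * ρ)) * m * 3) := by
          refine mul_le_mul_of_nonneg_left ?_ hnQ0
          refine mul_le_mul ?_ hfrac (div_nonneg (by linarith) (by linarith)) (by positivity)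
          exact mul_le_mul_of_nonneg_right
            (mul_le_mul_of_nonneg_left (mul_le_mul_of_nonneg_left hΛ (Nat.cast_nonneg _)) hσr.le)
            hm0
      _ ≤ (101 / 100 * y / L) * (σ ^ r * (r * (2 * σ ^ r * ρ)) * m * 3) :=
          mul_le_mul_of_nonneg_right hnQ (by positivity)
      _ = σ ^ (2 * r) * X * (303 / 100 * (r * ρ * ur)) / L := by
          rw [hm, ← hσ2r]; field_simp; ring
      _ ≤ σ ^ (2 * r) * X * (1 / (6400 * L₂ ^ 5)) / L := by
          refine div_le_div_of_nonneg_right (mul_le_mul_of_nonneg_left ?_ (by positivity)) hL0.le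
          rw [le_div_iff₀ (by positivity)]
          linarith
      _ = σ ^ (2 * r) * X / (32 * L * L₂ ^ 5) / 200 := by
          field_simp; ring
  calc EF ≤ _ := hEF
    _ = nQ * (σ ^ (2 * r - 1) * m ^ 2 *
          ((1 + 3 * ε₁) ^ 2 / (1 - δ₂) - 2 * (1 - 3 * ε₁) * Ee + 1)) +
        nQ * (σ ^ r * (r * Λ) * ((1 + 3 * ε₁) * m) / (1 - δ₂)) := by ring
    _ ≤ σ ^ (2 * r) * X / (32 * L * L₂ ^ 5) / 200 +
        σ ^ (2 * r) * X / (32 * L * L₂ ^ 5) / 200 := add_le_add hT1 hT2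
    _ = σ ^ (2 * r) * X / (32 * L * L₂ ^ 5) / 100 := by ring

/-- **The bad-primes budget (bad event B3).** From Lemma 6.3 in the form
`E Σ_{p ∉ 𝒫(a⃗)} X_p(a⃗) ≤ |𝒫|(σ^r/(1−δ₁) − (1−η)σ^r(1−β))`,
`β = ((1/(1−δ₂) − 2e^{−E} + 1) + r²Λ/((1−δ₂)σ^r))/η²`, with `δ₁ ≤ δ₂ ≤ 2/log^{18} x`,
`e^{−E} ≥ 1 − 4/log^{19} x`, `Λ ≤ 2σ^r x^{-2/3+3/100}`, `r² ≤ log x`, `η = log^{-3} x`: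
`E(…) ≤ 2|𝒫|σ^r/log³ x`. [cite: FordGreenKonyaginMaynardTao2018, Lemma 6.3 p. 18] -/
theorem thm4_EF3_num {EF nP σr δ₁ δ₂ Ee Λ ρ η rr L : ℝ}
    (hEF : EF ≤ nP * (σr / (1 - δ₁) - (1 - η) * σr *
        (1 - ((1 / (1 - δ₂) - 2 * Ee + 1) + rr ^ 2 * Λ / ((1 - δ₂) * σr)) / η ^ 2)))
    (hnP : 0 ≤ nP) (hσr : 0 < σr) (hδ₁0 : 0 ≤ δ₁) (hδ₁₂ : δ₁ ≤ δ₂) (hδ₂ : δ₂ ≤ 2 / L ^ 18)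
    (hEe : 1 - 4 / L ^ 19 ≤ Ee) (hEe1 : Ee ≤ 1) (hΛ0 : 0 ≤ Λ) (hΛ : Λ ≤ 2 * σr * ρ)
    (hρ : 0 ≤ ρ) (hG : L ^ 20 * ρ ≤ 1) (hrr : rr ^ 2 ≤ L) (hη : η = 1 / L ^ 3)
    (hL : 2 ≤ L) : EF ≤ 2 * nP * σr / L ^ 3 := by
  have hL0 : 0 < L := by linarith
  have hL1 : 1 ≤ L := by linarith
  have hL18 : (4 : ℝ) ≤ L ^ 18 := le_trans (by norm_num) (pow_le_pow_left₀ (by norm_num) hL 18)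
  -- reciprocal atoms
  obtain ⟨a18, ha18⟩ : ∃ t : ℝ, t = 1 / L ^ 18 := ⟨_, rfl⟩
  obtain ⟨a19, ha19⟩ : ∃ t : ℝ, t = 1 / L ^ 19 := ⟨_, rfl⟩
  obtain ⟨a3, ha3⟩ : ∃ t : ℝ, t = 1 / L ^ 3 := ⟨_, rfl⟩
  have ha18pos : 0 ≤ a18 := by rw [ha18]; positivity
  have ha19pos : 0 ≤ a19 := by rw [ha19]; positivity
  have ha3pos : 0 < a3 := by rw [ha3]; positivity
  have ha1918 : a19 ≤ a18 := by
    rw [ha18, ha19]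
    exact div_le_div_of_nonneg_left (by norm_num) (by positivity)
      (pow_le_pow_right₀ hL1 (by norm_num))
  have ha18le : a18 ≤ 1 / 4 := by
    rw [ha18]; exact div_le_div_of_nonneg_left (by norm_num) (by norm_num) hL18
  have hδ' : δ₂ ≤ 2 * a18 := by rw [ha18, ← div_eq_mul_one_div]; exact hδ₂
  have hEe' : 1 - 4 * a19 ≤ Ee := by rw [ha19, ← div_eq_mul_one_div]; exact hEe
  have hδ₂0 : 0 ≤ δ₂ := hδ₁0.trans hδ₁₂
  have hδ₂half : δ₂ ≤ 1 / 2 := by linarith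
  have hδ₁half : δ₁ ≤ 1 / 2 := hδ₁₂.trans hδ₂half
  have hη0 : 0 < η := by rw [hη]; positivity
  have hηa : η = a3 := by rw [hη, ha3]
  -- `18 a18 ≤ a3` and `a3 ≤ 1`: the room `log¹⁵ x ≥ 36`
  have ha18a3 : 36 * a18 ≤ a3 := by
    rw [ha18, ha3, mul_one_div, div_le_div_iff₀ (by positivity) (by positivity)]
    have h36 : (36 : ℝ) ≤ L ^ 15 := le_trans (by norm_num) (pow_le_pow_left₀ (by norm_num) hL 15)
    calc 36 * L ^ 3 ≤ L ^ 15 * L ^ 3 := mul_le_mul_of_nonneg_right h36 (by positivity)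
      _ = 1 * L ^ 18 := by ring
  -- `β ≥ 0`
  set β : ℝ := ((1 / (1 - δ₂) - 2 * Ee + 1) + rr ^ 2 * Λ / ((1 - δ₂) * σr)) / η ^ 2 with hβ
  have hb1 : 0 ≤ 1 / (1 - δ₂) - 2 * Ee + 1 := by
    have : 1 ≤ 1 / (1 - δ₂) := by rw [le_div_iff₀ (by linarith)]; linarith
    linarith
  have hb2 : 0 ≤ rr ^ 2 * Λ / ((1 - δ₂) * σr) :=
    div_nonneg (by positivity) (mul_nonneg (by linarith) hσr.le)
  have hβ0 : 0 ≤ β := div_nonneg (add_nonneg hb1 hb2) (by positivity)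
  -- `β ≤ 14 a18 / η²`
  have hb1' : 1 / (1 - δ₂) - 2 * Ee + 1 ≤ 2 * δ₂ + 8 * a19 := by
    have := thm4_one_div_one_sub_le hδ₂0 hδ₂half
    linarith
  have hb2' : rr ^ 2 * Λ / ((1 - δ₂) * σr) ≤ 4 * L * ρ := by
    rw [div_le_iff₀ (mul_pos (by linarith) hσr)]
    calc rr ^ 2 * Λ ≤ L * (2 * σr * ρ) := mul_le_mul hrr hΛ hΛ0 hL0.le
      _ = 4 * L * ρ * ((1 / 2) * σr) := by ring
      _ ≤ 4 * L * ρ * ((1 - δ₂) * σr) :=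
          mul_le_mul_of_nonneg_left (mul_le_mul_of_nonneg_right (by linarith) hσr.le)
            (by positivity)
  have h4Lρ : 4 * L * ρ ≤ 2 * a18 := by
    rw [ha18, mul_one_div, le_div_iff₀ (by positivity)]
    have h19 : 0 ≤ L ^ 19 * ρ := by positivity
    have h2L : 0 ≤ (2 * L - 4) * (L ^ 19 * ρ) := mul_nonneg (by linarith) h19
    calc 4 * L * ρ * L ^ 18 = 4 * (L ^ 19 * ρ) := by ring
      _ ≤ 2 * L * (L ^ 19 * ρ) := by linarith
      _ = 2 * (L ^ 20 * ρ) := by ring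
      _ ≤ 2 := by linarith
  have hβ' : β * η ^ 2 ≤ 14 * a18 := by
    have e : β * η ^ 2 = (1 / (1 - δ₂) - 2 * Ee + 1) + rr ^ 2 * Λ / ((1 - δ₂) * σr) := by
      rw [hβ]; field_simp
    rw [e]; linarith
  -- `2δ₁ + η + β ≤ 2/log³ x`
  have hmain := thm4_bracket_bad hσr.le hδ₁0 hδ₁half hη0.le hβ0
  have hsum : 2 * δ₁ + η + β ≤ 2 * a3 := by
    have hβ'' : β ≤ 14 * a18 / a3 ^ 2 := by
      rw [le_div_iff₀ (by positivity), ← hηa]; exact hβ'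
    have h14 : 14 * a18 / a3 ^ 2 ≤ a3 / 2 := by
      rw [div_le_iff₀ (by positivity)]
      -- `14 a18 ≤ a3³/2`: from `36 a18 ≤ a3` and ... no: use `a18 ≤ a3 · a3² / 28`? we use L directly
      rw [ha18, ha3]
      rw [show (1 : ℝ) / L ^ 3 / 2 * (1 / L ^ 3) ^ 2 = 1 / (2 * L ^ 9) by field_simp]
      rw [mul_one_div, div_le_div_iff₀ (by positivity) (by positivity)]
      have h28 : (28 : ℝ) ≤ L ^ 9 := le_trans (by norm_num) (pow_le_pow_left₀ (by norm_num) hL 9)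
      calc 14 * (2 * L ^ 9) = 28 * L ^ 9 := by ring
        _ ≤ L ^ 9 * L ^ 9 := mul_le_mul_of_nonneg_right h28 (by positivity)
        _ = 1 * L ^ 18 := by ring
    have hδ₁' : 2 * δ₁ ≤ 4 * a18 := by linarith
    rw [hηa]
    linarith
  calc EF ≤ _ := hEF
    _ ≤ nP * (σr * (2 * δ₁ + η + β)) := mul_le_mul_of_nonneg_left hmain hnP
    _ ≤ nP * (σr * (2 * a3)) :=
        mul_le_mul_of_nonneg_left (mul_le_mul_of_nonneg_left hsum hσr.le) hnP
    _ = 2 * nP * σr / L ^ 3 := by rw [ha3]; ring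

/-- **(4.29): `C = u x/(2σy) ≍ 1/c`** — from `u₁ log r ≤ u ≤ u₂ log r` (6.2′),
`log₂ x/10 ≤ log r ≤ log₂ x/5` (6.1) and (6.9) `σ y = (1 + O_≤(1/100)) 80 c x log₂ x`:
`u₁/(2000 c) ≤ C ≤ u₂/(700 c)`. [cite: FordGreenKonyaginMaynardTao2018, (4.29) and p. 18] -/
theorem thm4_C_bounds {m σ ur X y u₁ u₂ lr L₂ c : ℝ} (hc : 0 < c) (hX : 0 < X) (hy : 0 < y)
    (hσ : 0 < σ) (hm : m = ur * X / (2 * y)) (hu₁ : 0 < u₁) (hur₁ : u₁ * lr ≤ ur)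
    (hur₂ : ur ≤ u₂ * lr) (hlr₁ : L₂ / 10 ≤ lr) (hlr₂ : lr ≤ L₂ / 5) (hL₂ : 0 < L₂)
    (hσy₁ : 99 / 100 * (80 * c * X * L₂) ≤ σ * y)
    (hσy₂ : σ * y ≤ 101 / 100 * (80 * c * X * L₂)) :
    u₁ / 2000 / c ≤ m / σ ∧ m / σ ≤ u₂ / 700 / c := by
  have hσy0 : 0 < σ * y := mul_pos hσ hy
  have hmσ : m / σ = ur * X / (2 * (σ * y)) := by rw [hm]; field_simp
  have hlr0 : 0 < lr := lt_of_lt_of_le (by positivity) hlr₁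
  have hur0 : 0 < ur := lt_of_lt_of_le (mul_pos hu₁ hlr0) hur₁
  have hu₂ : 0 < u₂ := by
    by_contra h
    have : u₂ * lr ≤ 0 := mul_nonpos_of_nonpos_of_nonneg (not_lt.1 h) hlr0.le
    linarith
  have hcXL : 0 < c * X * L₂ := by positivity
  rw [hmσ]
  constructor
  · rw [div_div, div_le_div_iff₀ (by positivity) (by positivity)]
    have h1 : u₁ * (L₂ / 10) ≤ ur := le_trans (mul_le_mul_of_nonneg_left hlr₁ hu₁.le) hur₁
    have h2 : u₁ * (L₂ / 10) * (X * 1616 * c) ≤ ur * (X * 1616 * c) :=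
      mul_le_mul_of_nonneg_right h1 (by positivity)
    have h3 : 0 < ur * X * c := by positivity
    calc u₁ * (2 * (σ * y)) ≤ u₁ * (2 * (101 / 100 * (80 * c * X * L₂))) :=
          mul_le_mul_of_nonneg_left (by linarith) hu₁.le
      _ = u₁ * (L₂ / 10) * (X * 1616 * c) := by ring
      _ ≤ ur * (X * 1616 * c) := h2
      _ ≤ ur * X * (2000 * c) := by linarith
  · rw [div_div, div_le_div_iff₀ (by positivity) (by positivity)]
    have h1 : ur ≤ u₂ * (L₂ / 5) := hur₂.trans (mul_le_mul_of_nonneg_left hlr₂ hu₂.le)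
    have h2 : ur * (X * (700 * c)) ≤ u₂ * (L₂ / 5) * (X * (700 * c)) :=
      mul_le_mul_of_nonneg_right h1 (by positivity)
    have h3 : 0 < u₂ * (c * X * L₂) := by positivity
    calc ur * X * (700 * c) = ur * (X * (700 * c)) := by ring
      _ ≤ u₂ * (L₂ / 5) * (X * (700 * c)) := h2
      _ = u₂ * (140 * c * X * L₂) := by ring
      _ ≤ u₂ * (2 * (99 / 100 * (80 * c * X * L₂))) := by linarith
      _ ≤ u₂ * (2 * (σ * y)) := mul_le_mul_of_nonneg_left (by linarith) hu₂.le

/-- **The error of (4.28)**: `κ + κ' + 2η(C + κ) ≤ 1/log₂² x` for `κ = κ' = 1/(4 log₂² x)`,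
`η = 1/log³ x`, once `4 log₂² x (C + 1) ≤ log³ x`.
[cite: FordGreenKonyaginMaynardTao2018, (4.28) from (6.13) and Lemma 6.2, p. 18] -/
theorem thm4_final_num {C L L₂ : ℝ} (hC : 0 ≤ C) (hL₂ : 1 ≤ L₂) (hL : 0 < L)
    (hfin : 4 * L₂ ^ 2 * (C + 1) ≤ L ^ 3) :
    1 / (4 * L₂ ^ 2) + 1 / (4 * L₂ ^ 2) + 2 * (1 / L ^ 3) * (C + 1 / (4 * L₂ ^ 2)) ≤
      1 / L₂ ^ 2 := by
  have hL₂0 : 0 < L₂ := by linarith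
  obtain ⟨κ, hκ⟩ : ∃ t : ℝ, t = 1 / (4 * L₂ ^ 2) := ⟨_, rfl⟩
  have hκ0 : 0 < κ := by rw [hκ]; positivity
  have hκ1 : κ ≤ 1 := by
    rw [hκ, div_le_one (by positivity)]; nlinarith
  have e1 : (1 : ℝ) / L₂ ^ 2 = 4 * κ := by rw [hκ]; field_simp
  rw [← hκ, e1]
  have h3 : 2 * (1 / L ^ 3) * (C + κ) ≤ 2 * κ := by
    calc 2 * (1 / L ^ 3) * (C + κ) ≤ 2 * (1 / L ^ 3) * (C + 1) :=
          mul_le_mul_of_nonneg_left (by linarith) (by positivity)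
      _ = 2 * (C + 1) / L ^ 3 := by ring
      _ ≤ 2 * (C + 1) / (4 * L₂ ^ 2 * (C + 1)) :=
          div_le_div_of_nonneg_left (by positivity) (by positivity) hfin
      _ = 2 * κ := by rw [hκ]; field_simp
  linarith

/-- `t₂/κ₀² = x/(2 log x log₂ x)` for `t₂ = σ^{2r} x/(32 log x log₂⁵ x)`, `κ₀ = σ^r/(4 log₂² x)`.
[cite: FordGreenKonyaginMaynardTao2018, p. 18 (Markov for the number of `q` violating (6.14))] -/
theorem thm4_t2_div_sq {σ X L L₂ : ℝ} {r : ℕ} (hσ : 0 < σ) (hL : 0 < L) (hL₂ : 0 < L₂) :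
    σ ^ (2 * r) * X / (32 * L * L₂ ^ 5) / (σ ^ r / (4 * L₂ ^ 2)) ^ 2 = X / (2 * L * L₂) := by
  have hσr : 0 < σ ^ r := pow_pos hσ r
  have hσ2r : σ ^ (2 * r) = σ ^ r * σ ^ r := by rw [two_mul, pow_add]
  rw [hσ2r]
  field_simp
  ring

/-- The count of `E₃`: `160 r (|𝒫| + 1) log₂² x/log³ x ≤ x/(2 log x log₂ x)` from `|𝒫| ≤ x`,
`200 r log₂ x ≤ log x` and `81 log₂² x ≤ log x`.
[cite: FordGreenKonyaginMaynardTao2018, p. 18 (the primes outside `𝒫(a⃗)`)] -/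
theorem thm4_E3_num {nP X rr L L₂ : ℝ} (hnP : nP ≤ X) (hX1 : 1 ≤ X) (hrr : 0 ≤ rr)
    (h200 : 200 * (rr * L₂) ≤ L) (h81 : 81 * L₂ ^ 2 ≤ L) (hL : 0 < L) (hL₂ : 0 < L₂) :
    160 * rr * (nP + 1) * L₂ ^ 2 / L ^ 3 ≤ X / (2 * L * L₂) := by
  have h1 : 640 * rr * L₂ ^ 3 ≤ L ^ 2 := by
    have hLL : 0 < L * L := mul_pos hL hL
    calc 640 * rr * L₂ ^ 3 = 640 * (rr * L₂) * L₂ ^ 2 := by ring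
      _ ≤ 640 * (L / 200) * (L / 81) := by
          refine mul_le_mul (mul_le_mul_of_nonneg_left (by linarith) (by norm_num)) (by linarith)
            (by positivity) (by positivity)
      _ ≤ L ^ 2 := by nlinarith
  rw [div_le_div_iff₀ (by positivity) (by positivity)]
  have hnP1 : nP + 1 ≤ 2 * X := by linarith
  calc 160 * rr * (nP + 1) * L₂ ^ 2 * (2 * L * L₂) = (nP + 1) * L * (320 * rr * L₂ ^ 3) := by
        ring
    _ ≤ (2 * X) * L * (L ^ 2 / 2) := by
        refine mul_le_mul (mul_le_mul_of_nonneg_right hnP1 hL.le) (by linarith)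
          (by positivity) (by positivity)
    _ = X * L ^ 3 := by ring

/-! ### §4. The exceptional sets `E₂`, `E₃` of primes `q ∈ 𝒬 ∩ S(a⃗)` and the goodness of the rest -/

/-- `#E₂ ≤ (Σ_q 1_{q ∈ S(a⃗)} (Y_q − m')²)/κ²` where `E₂ := {q ∈ 𝒬 ∩ S(a⃗) : |Y_q − m'| ≥ κ}`
(Chebyshev count of the `q` violating (6.17), transported from `ℤ` to `ℕ`).
[cite: FordGreenKonyaginMaynardTao2018, (6.17) p. 18] -/
theorem thm4_card_E2_le {c : ℝ} {x : ℕ} (f : (s : ℕ) → s ∈ primesS x → ℕ) (H : Finset ℤ)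
    (lam : ℕ → ℤ → ℝ) (m' : ℝ) {κ : ℝ} (hκ : 0 < κ) :
    (#((sievedQ c x (extendRes (primesS x) f)).filter fun (q : ℕ) =>
        κ ≤ |Ylaw (primesS x) (primesHalf x) H lam f (q : ℤ) - m'|) : ℝ) ≤
      (∑ q ∈ (primesQ c x).image (Nat.cast : ℕ → ℤ), siftInd (primesS x) {q} f *
          (Ylaw (primesS x) (primesHalf x) H lam f q - m') ^ 2) / κ ^ 2 := by
  classical
  refine le_trans ?_ (card_bad_le f _ m' hκ)
  have hsub : ((sievedQ c x (extendRes (primesS x) f)).filter fun (q : ℕ) =>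
        κ ≤ |Ylaw (primesS x) (primesHalf x) H lam f (q : ℤ) - m'|).image (Nat.cast : ℕ → ℤ) ⊆
      ((primesQ c x).image (Nat.cast : ℕ → ℤ)).filter fun (q : ℤ) =>
        siftInd (primesS x) {q} f = 1 ∧ κ ≤ |Ylaw (primesS x) (primesHalf x) H lam f q - m'| := by
    intro q hq
    rw [Finset.mem_image] at hq
    obtain ⟨q', hq', rfl⟩ := hq
    rw [Finset.mem_filter] at hq'
    rw [Finset.mem_filter]
    exact ⟨Finset.mem_image_of_mem _ ((mem_sievedQ_extendRes f).1 hq'.1).1,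
      siftInd_singleton_eq_one_of_mem f hq'.1, hq'.2⟩
  have h := Finset.card_le_card hsub
  rw [Finset.card_image_of_injective _ Nat.cast_injective] at h
  exact_mod_cast h

/-- `#E₃ · t ≤ #H · Σ_p (1 − 1_{p good}) X_p(a⃗)` where `E₃ := {q ∈ 𝒬 ∩ S(a⃗) : bad part of (6.15) > t}`.
[cite: FordGreenKonyaginMaynardTao2018, (6.15)–(6.16) p. 18] -/
theorem thm4_card_E3_le {c : ℝ} {x : ℕ} {a : ℕ → ℕ} {H : Finset ℤ} {w : ℕ → ℤ → ℝ}
    {N : Finset ℤ} {X₀ η : ℝ} (hw : ∀ p n, 0 ≤ w p n) (hwN : ∀ p n, n ∉ N → w p n = 0)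
    (t : ℝ) :
    (#((sievedQ c x a).filter fun (q : ℕ) => t <
        ∑ h ∈ H, ∑ p ∈ (primesHalf x).filter (fun p => p ∉ goodPrimes x a H w N X₀ η),
          Zp x a H w N p ((q : ℤ) - h * (p : ℤ))) : ℝ) * t ≤
      #H * ∑ p ∈ primesHalf x,
        (if p ∈ goodPrimes x a H w N X₀ η then 0 else Xp x a H w N p) := by
  classical
  have h1 : (#((sievedQ c x a).filter fun (q : ℕ) => t <
        ∑ h ∈ H, ∑ p ∈ (primesHalf x).filter (fun p => p ∉ goodPrimes x a H w N X₀ η),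
          Zp x a H w N p ((q : ℤ) - h * (p : ℤ))) : ℝ) * t ≤
      ∑ q ∈ ((sievedQ c x a).filter fun (q : ℕ) => t <
        ∑ h ∈ H, ∑ p ∈ (primesHalf x).filter (fun p => p ∉ goodPrimes x a H w N X₀ η),
          Zp x a H w N p ((q : ℤ) - h * (p : ℤ))),
        ∑ h ∈ H, ∑ p ∈ (primesHalf x).filter (fun p => p ∉ goodPrimes x a H w N X₀ η),
          Zp x a H w N p ((q : ℤ) - h * (p : ℤ)) := by
    rw [← nsmul_eq_mul, ← Finset.sum_const]
    exact Finset.sum_le_sum fun q hq => ((Finset.mem_filter.1 hq).2).le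
  have h2 := sum_Zp_badPrimes_le (x := x) (H := H) (a := a) (X₀ := X₀) (η := η) hw hwN
    (((sievedQ c x a).filter fun (q : ℕ) => t <
        ∑ h ∈ H, ∑ p ∈ (primesHalf x).filter (fun p => p ∉ goodPrimes x a H w N X₀ η),
          Zp x a H w N p ((q : ℤ) - h * (p : ℤ))).image (Nat.cast : ℕ → ℤ))
  rw [Finset.sum_image Nat.cast_injective.injOn] at h2
  exact h1.trans h2

/-- **The good `q`** ((6.14) from (6.15)–(6.17) and `covering_sum_estimate`): if `q ∈ 𝒬 ∩ S(a⃗)` has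
`|Y_q − σ^{r−1} m| < σ^r/(4 log₂² x)` and bad part `≤ σ^r/(4 log₂² x)`, then with `C := m/σ`,
`η := 1/log³ x`: `|Σ_p P(q ∈ e_p | a⃗) − C| ≤ 1/log₂² x`.
[cite: FordGreenKonyaginMaynardTao2018, (6.14)–(6.17) p. 18] -/
theorem thm4_goodness {c : ℝ} {x : ℕ} {f : (s : ℕ) → s ∈ primesS x → ℕ} {H : Finset ℤ}
    {w : ℕ → ℤ → ℝ} {N : Finset ℤ} (hw : ∀ p n, 0 ≤ w p n) (hwN : ∀ p n, n ∉ N → w p n = 0)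
    (h0 : (0 : ℤ) ∈ N) (hH : 1 ≤ #H) {σ m L L₂ : ℝ} (hσ : 0 < σ)
    (hm : 0 ≤ m) (hL : 0 < L) (hL₂ : 1 ≤ L₂) (hη2 : 1 / L ^ 3 ≤ 1 / 2)
    (hfin : 4 * L₂ ^ 2 * (m / σ + 1) ≤ L ^ 3) {q : ℕ}
    (hq : q ∈ sievedQ c x (extendRes (primesS x) f))
    (hE₂ : |Ylaw (primesS x) (primesHalf x) H (fun p n => lawTilde w N p n) f (q : ℤ) -
        σ ^ (#H - 1) * m| < σ ^ #H / (4 * L₂ ^ 2))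
    (hE₃ : ∑ h ∈ H, ∑ p ∈ (primesHalf x).filter
        (fun p => p ∉ goodPrimes x (extendRes (primesS x) f) H w N (σ ^ #H) (1 / L ^ 3)),
          Zp x (extendRes (primesS x) f) H w N p ((q : ℤ) - h * (p : ℤ)) ≤
        1 / (4 * L₂ ^ 2) * σ ^ #H) :
    |∑ p ∈ primesHalf x, probInEdge c x (extendRes (primesS x) f) H N
        (condLaw x (extendRes (primesS x) f) H w N (σ ^ #H) (1 / L ^ 3)) p q - m / σ| ≤
      1 / L₂ ^ 2 := by
  have hX₀ : 0 < σ ^ #H := pow_pos hσ _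
  have hL₂0 : 0 < L₂ := by linarith
  have hσ0 : σ ≠ 0 := hσ.ne'
  have hpow : σ ^ #H = σ ^ (#H - 1) * σ := by
    rw [← pow_succ]; congr 1; omega
  have hκ : |(∑ h ∈ H, ∑ p ∈ primesHalf x, Zp x (extendRes (primesS x) f) H w N p
      ((q : ℤ) - h * (p : ℤ))) / σ ^ #H - m / σ| ≤ 1 / (4 * L₂ ^ 2) := by
    rw [← Ylaw_eq_sum_Zp]
    have e : Ylaw (primesS x) (primesHalf x) H (fun p n => lawTilde w N p n) f (q : ℤ) / σ ^ #H -
        m / σ = (Ylaw (primesS x) (primesHalf x) H (fun p n => lawTilde w N p n) f (q : ℤ) -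
          σ ^ (#H - 1) * m) / σ ^ #H := by
      have hσr0 : σ ^ (#H - 1) ≠ 0 := pow_ne_zero _ hσ0
      rw [hpow]
      field_simp
    rw [e, abs_div, abs_of_pos hX₀, div_le_iff₀ hX₀]
    exact hE₂.le.trans (le_of_eq (by ring))
  have hκ' : (∑ h ∈ H, ∑ p ∈ (primesHalf x).filter
      (fun p => p ∉ goodPrimes x (extendRes (primesS x) f) H w N (σ ^ #H) (1 / L ^ 3)),
        Zp x (extendRes (primesS x) f) H w N p ((q : ℤ) - h * (p : ℤ))) / σ ^ #H ≤
      1 / (4 * L₂ ^ 2) := by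
    rw [div_le_iff₀ hX₀]; exact hE₃
  refine (covering_sum_estimate (c := c) hw hwN h0 hX₀ (by positivity) hη2 hq hκ hκ').trans ?_
  exact thm4_final_num (div_nonneg hm hσ.le) hL₂ hL hfin

/-- **`#(E₂ ∪ E₃) ≤ x/(log x log₂ x)`** for a residue vector with `F₂(a⃗) < t₂`, `F₃(a⃗) < t₃`.
[cite: FordGreenKonyaginMaynardTao2018, Thm 4 from (6.15)–(6.17), p. 18] -/
theorem thm4_card_E_le {c : ℝ} {x : ℕ} {H : Finset ℤ} {w : ℕ → ℤ → ℝ}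
    (f : (s : ℕ) → s ∈ primesS x → ℕ) {m : ℝ} (hw : ∀ p n, 0 ≤ w p n)
    (hwN : ∀ p n, n ∉ weightWindow c x → w p n = 0)
    (hx1 : (1 : ℝ) ≤ x) (hL2 : 2 ≤ Real.log x) (hL₂1 : 1 ≤ Real.log (Real.log x))
    (h81 : 81 * Real.log (Real.log x) ^ 2 ≤ Real.log x)
    (h200 : 200 * ((#H : ℝ) * Real.log (Real.log x)) ≤ Real.log x)
    (hσ : 0 < sigmaProd (primesS x))
    (hF2 : ∑ q ∈ (primesQ c x).image (Nat.cast : ℕ → ℤ), siftInd (primesS x) {q} f *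
          (Ylaw (primesS x) (primesHalf x) H (fun p n => lawTilde w (weightWindow c x) p n) f q -
            sigmaProd (primesS x) ^ (#H - 1) * m) ^ 2 <
        sigmaProd (primesS x) ^ (2 * #H) * x / (32 * Real.log x * Real.log (Real.log x) ^ 5))
    (hF3 : ∑ p ∈ primesHalf x,
          (if p ∈ goodPrimes x (extendRes (primesS x) f) H w (weightWindow c x)
              (sigmaProd (primesS x) ^ #H) (1 / Real.log x ^ 3) then 0
          else Xp x (extendRes (primesS x) f) H w (weightWindow c x) p) <
        40 * ((#(primesHalf x) : ℝ) + 1) * sigmaProd (primesS x) ^ #H / Real.log x ^ 3) :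
    (#(((sievedQ c x (extendRes (primesS x) f)).filter fun (q : ℕ) =>
          sigmaProd (primesS x) ^ #H / (4 * Real.log (Real.log x) ^ 2) ≤
            |Ylaw (primesS x) (primesHalf x) H (fun p n => lawTilde w (weightWindow c x) p n) f
                (q : ℤ) - sigmaProd (primesS x) ^ (#H - 1) * m|) ∪
        ((sievedQ c x (extendRes (primesS x) f)).filter fun (q : ℕ) =>
          1 / (4 * Real.log (Real.log x) ^ 2) * sigmaProd (primesS x) ^ #H <
            ∑ h ∈ H, ∑ p ∈ (primesHalf x).filter (fun p => p ∉ goodPrimes x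
                (extendRes (primesS x) f) H w (weightWindow c x) (sigmaProd (primesS x) ^ #H)
                (1 / Real.log x ^ 3)),
              Zp x (extendRes (primesS x) f) H w (weightWindow c x) p ((q : ℤ) - h * (p : ℤ)))) :
        ℝ) ≤ x / (Real.log x * Real.log (Real.log x)) := by
  classical
  have hL0 : 0 < Real.log x := by linarith
  have hL₂0 : 0 < Real.log (Real.log x) := by linarith
  have hx0 : (0 : ℝ) < x := by linarith
  have hκ₀ : 0 < sigmaProd (primesS x) ^ #H / (4 * Real.log (Real.log x) ^ 2) := by positivity
  have hE2 : (#((sievedQ c x (extendRes (primesS x) f)).filter fun (q : ℕ) =>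
          sigmaProd (primesS x) ^ #H / (4 * Real.log (Real.log x) ^ 2) ≤
            |Ylaw (primesS x) (primesHalf x) H (fun p n => lawTilde w (weightWindow c x) p n) f
                (q : ℤ) - sigmaProd (primesS x) ^ (#H - 1) * m|) : ℝ) ≤
      x / (2 * Real.log x * Real.log (Real.log x)) := by
    refine (thm4_card_E2_le f H _ _ hκ₀).trans ?_
    rw [← thm4_t2_div_sq (X := (x : ℝ)) (r := #H) hσ hL0 hL₂0]
    exact div_le_div_of_nonneg_right hF2.le (by positivity)
  have hE3 : (#((sievedQ c x (extendRes (primesS x) f)).filter fun (q : ℕ) =>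
          1 / (4 * Real.log (Real.log x) ^ 2) * sigmaProd (primesS x) ^ #H <
            ∑ h ∈ H, ∑ p ∈ (primesHalf x).filter (fun p => p ∉ goodPrimes x
                (extendRes (primesS x) f) H w (weightWindow c x) (sigmaProd (primesS x) ^ #H)
                (1 / Real.log x ^ 3)),
              Zp x (extendRes (primesS x) f) H w (weightWindow c x) p ((q : ℤ) - h * (p : ℤ))) :
        ℝ) ≤ x / (2 * Real.log x * Real.log (Real.log x)) := by
    have h := thm4_card_E3_le (c := c) (x := x) (a := extendRes (primesS x) f) (H := H)
      (N := weightWindow c x) (X₀ := sigmaProd (primesS x) ^ #H) (η := 1 / Real.log x ^ 3) hw hwN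
      (1 / (4 * Real.log (Real.log x) ^ 2) * sigmaProd (primesS x) ^ #H)
    have h' := h.trans (mul_le_mul_of_nonneg_left hF3.le (Nat.cast_nonneg _))
    have hpos : 0 < 1 / (4 * Real.log (Real.log x) ^ 2) * sigmaProd (primesS x) ^ #H := by
      positivity
    rw [← le_div_iff₀ hpos] at h'
    have hP : (#(primesHalf x) : ℝ) ≤ x := by
      have : #(primesHalf x) ≤ x :=
        calc #(primesHalf x) ≤ #(Finset.Icc 1 x) := Finset.card_filter_le _ _
          _ = x := by simp
      exact_mod_cast this
    have key := thm4_E3_num hP hx1 (Nat.cast_nonneg #H) h200 h81 hL0 hL₂0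
    refine h'.trans (le_trans (le_of_eq ?_) key)
    field_simp
    ring
  calc (#(((sievedQ c x (extendRes (primesS x) f)).filter fun (q : ℕ) =>
          sigmaProd (primesS x) ^ #H / (4 * Real.log (Real.log x) ^ 2) ≤
            |Ylaw (primesS x) (primesHalf x) H (fun p n => lawTilde w (weightWindow c x) p n) f
                (q : ℤ) - sigmaProd (primesS x) ^ (#H - 1) * m|) ∪
        ((sievedQ c x (extendRes (primesS x) f)).filter fun (q : ℕ) =>
          1 / (4 * Real.log (Real.log x) ^ 2) * sigmaProd (primesS x) ^ #H <
            ∑ h ∈ H, ∑ p ∈ (primesHalf x).filter (fun p => p ∉ goodPrimes x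
                (extendRes (primesS x) f) H w (weightWindow c x) (sigmaProd (primesS x) ^ #H)
                (1 / Real.log x ^ 3)),
              Zp x (extendRes (primesS x) f) H w (weightWindow c x) p ((q : ℤ) - h * (p : ℤ)))) :
        ℝ) ≤ (#((sievedQ c x (extendRes (primesS x) f)).filter fun (q : ℕ) =>
          sigmaProd (primesS x) ^ #H / (4 * Real.log (Real.log x) ^ 2) ≤
            |Ylaw (primesS x) (primesHalf x) H (fun p n => lawTilde w (weightWindow c x) p n) f
                (q : ℤ) - sigmaProd (primesS x) ^ (#H - 1) * m|) : ℝ) +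
        (#((sievedQ c x (extendRes (primesS x) f)).filter fun (q : ℕ) =>
          1 / (4 * Real.log (Real.log x) ^ 2) * sigmaProd (primesS x) ^ #H <
            ∑ h ∈ H, ∑ p ∈ (primesHalf x).filter (fun p => p ∉ goodPrimes x
                (extendRes (primesS x) f) H w (weightWindow c x) (sigmaProd (primesS x) ^ #H)
                (1 / Real.log x ^ 3)),
              Zp x (extendRes (primesS x) f) H w (weightWindow c x) p ((q : ℤ) - h * (p : ℤ))) :
        ℝ) := by exact_mod_cast Finset.card_union_le _ _
    _ ≤ x / (2 * Real.log x * Real.log (Real.log x)) + x / (2 * Real.log x * Real.log (Real.log x)) :=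
        add_le_add hE2 hE3
    _ = x / (Real.log x * Real.log (Real.log x)) := by ring

/-! ### §5. The expectations of the second and third bad events, and a good residue vector -/

/-- **`E F₂ ≤ t₂/100`**: the expectation over `a⃗` of `Σ_{q ∈ 𝒬} 1_{q ∈ S(a⃗)} (Y_q − σ^{r−1} m)²`
(Lemma 6.2 / (6.17) second moment, engine `boxExp_sum_sq_dev_le` fed with (6.3), (6.4), (6.6))
is at most `σ^{2r} x/(3200 log x log₂⁵ x)` at a large `x`.
[cite: FordGreenKonyaginMaynardTao2018, Lemma 6.2 and (6.16)–(6.17), pp. 18–19] -/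
theorem thm4_boxExp_F2_le {c : ℝ} {x : ℕ} {H : Finset ℤ} {w : ℕ → ℤ → ℝ} {K τ u₂ ur : ℝ}
    (hc : 0 < c) (hx1 : (1 : ℝ) ≤ x)
    (hL2 : 2 ≤ Real.log x) (hL₂1 : 1 ≤ Real.log (Real.log x))
    (hxy : (x : ℝ) ≤ ySieve c x)
    (hLσ : (Real.log x / sigmaProd (primesS x)) ^ #H ≤ (x : ℝ) ^ ((1 : ℝ) / 100))
    (hρ : Real.log x ^ 20 * (x : ℝ) ^ (-(2 / 3 : ℝ) + 3 / 100) ≤ (x : ℝ) ^ (-(3 / 5 : ℝ)))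
    (hσy : 99 / 100 * (80 * c * x * Real.log (Real.log x)) ≤ sigmaProd (primesS x) * ySieve c x)
    (hnQ : (#(primesQ c x) : ℝ) ≤ 101 / 100 * ySieve c x / Real.log x)
    (hH1 : 1 ≤ #H) (hrL : (#H : ℝ) ≤ Real.log x) (h2r : 2 * #H ≤ sMin x)
    (hδ : (2 * (#H : ℝ)) ^ 3 * Real.log ((x : ℝ) ^ 3) / (sMin x * Real.log (sMin x)) ≤
      2 / Real.log x ^ 18)
    (hEe : 1 - 4 / Real.log x ^ 19 ≤
      Real.exp (-(2 * (#H : ℝ) ^ 2 * ∑ s ∈ primesS x, 1 / (s : ℝ) ^ 2)))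
    (hHb : ∀ h ∈ H, 1 ≤ h ∧ h ≤ 2 * (#H : ℤ) ^ 2)
    (hdiam : 4 * (#H : ℝ) ^ 2 * x ≤ (x : ℝ) ^ 3) (h4rx : 4 * (#H : ℝ) ^ 2 ≤ x)
    (hK : 0 < K) (hu₂ : 0 ≤ u₂) (hur0 : 0 ≤ ur) (hur : ur ≤ u₂ * Real.log (Real.log x) / 5)
    (hA : 100 * K ≤ Real.log (Real.log x) ^ 10)
    (hB2a : 30 * K * u₂ ^ 2 / c ≤ Real.log (Real.log x) ^ 4)
    (hB2b : 32 * u₂ ^ 2 / c ≤ Real.log x) (hB2c : 3879 * u₂ ≤ Real.log x)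
    (hτ : (x : ℝ) ^ (-(1 / 100 : ℝ)) ≤ τ)
    (hw : ∀ p n, 0 ≤ w p n)
    (hsupp : ∀ p n, w p n ≠ 0 → p ∈ primesHalf x ∧ |(n : ℝ)| ≤ ySieve c x)
    (h63 : ∀ p ∈ primesHalf x, |∑ n ∈ weightWindow c x, w p n - τ * ySieve c x / Real.log x ^ #H|
        ≤ K / Real.log (Real.log x) ^ 10 * (τ * ySieve c x / Real.log x ^ #H))
    (h64 : ∀ q ∈ primesQ c x, ∀ h ∈ H, |∑ p ∈ primesHalf x, w p ((q : ℤ) - h * p)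
          - τ * (ur / #H) * ((x : ℝ) / (2 * Real.log x ^ #H))|
        ≤ K / Real.log (Real.log x) ^ 10 * (τ * (ur / #H) * ((x : ℝ) / (2 * Real.log x ^ #H))))
    (hWle : ∀ p n, w p n ≤ (x : ℝ) ^ (1 / 3 + 1 / 100 : ℝ)) :
    boxExp (primesS x) (fun f => ∑ q ∈ (primesQ c x).image (Nat.cast : ℕ → ℤ),
      siftInd (primesS x) {q} f *
        (Ylaw (primesS x) (primesHalf x) H (fun p n => lawTilde w (weightWindow c x) p n) f q -
          sigmaProd (primesS x) ^ (#H - 1) *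
            (#H * (τ * (ur / #H) * ((x : ℝ) / (2 * Real.log x ^ #H)) /
              (τ * ySieve c x / Real.log x ^ #H)))) ^ 2) ≤
      sigmaProd (primesS x) ^ (2 * #H) * x / (32 * Real.log x * Real.log (Real.log x) ^ 5) /
        100 := by
  classical
  -- atoms for `D`, `E`, `ε₁`
  obtain ⟨D, hDdef⟩ : ∃ D : ℝ, D = τ * ySieve c x / Real.log x ^ #H := ⟨_, rfl⟩
  obtain ⟨Em, hEmdef⟩ : ∃ E : ℝ, E = τ * (ur / #H) * ((x : ℝ) / (2 * Real.log x ^ #H)) :=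
    ⟨_, rfl⟩
  obtain ⟨ε₁, hε₁def⟩ : ∃ e : ℝ, e = K / Real.log (Real.log x) ^ 10 := ⟨_, rfl⟩
  rw [← hDdef, ← hEmdef]
  rw [← hDdef, ← hε₁def] at h63
  rw [← hEmdef, ← hε₁def] at h64
  -- positivity bookkeeping
  have hL0 : 0 < Real.log x := by linarith
  have hL1 : 1 ≤ Real.log x := by linarith
  have hL₂0 : 0 < Real.log (Real.log x) := by linarith
  have hL₂L : Real.log (Real.log x) ≤ Real.log x :=
    (Real.log_le_sub_one_of_pos hL0).trans (by linarith)
  have hx0 : (0 : ℝ) < x := by linarith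
  have hy0 : 0 < ySieve c x := lt_of_lt_of_le hx0 hxy
  have hS : ∀ s ∈ primesS x, s.Prime := fun s hs => prime_of_mem_primesS hs
  have hS1 : ∀ s ∈ primesS x, 1 < s := fun s hs => (hS s hs).one_lt
  have hσ : 0 < sigmaProd (primesS x) := sigmaProd_pos hS1
  have hs₀ : 2 ≤ sMin x := two_le_sMin hL1
  have hSs₀ : ∀ s ∈ primesS x, sMin x ≤ s := fun s hs => sMin_le_of_mem hs
  have hP0 : ∀ p ∈ primesHalf x, p ≠ 0 := fun p hp => (pos_of_mem_primesHalf hp).ne'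
  have hPprime : ∀ p ∈ primesHalf x, p.Prime := fun p hp => (prime_of_mem_primesHalf hp).1
  have hH0 : (0 : ℝ) < #H := by exact_mod_cast hH1
  have hτ0 : 0 < τ := lt_of_lt_of_le (Real.rpow_pos_of_pos hx0 _) hτ
  -- `ε₁`, `D`, `E`, `m`
  have hε₁0 : 0 ≤ ε₁ := by rw [hε₁def]; positivity
  have hε₁1 : ε₁ ≤ 1 / 100 := by
    rw [hε₁def, div_le_div_iff₀ (by positivity) (by norm_num)]; linarith
  have hε₁K : ε₁ * Real.log (Real.log x) ^ 10 = K := by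
    rw [hε₁def]; field_simp
  have hD0 : 0 < D := by rw [hDdef]; positivity
  have hEm0 : 0 ≤ Em := by rw [hEmdef]; positivity
  have hm0 : (0 : ℝ) ≤ #H * (Em / D) := by positivity
  have hmid : #H * (Em / D) = ur * x / (2 * ySieve c x) := by
    rw [hEmdef, hDdef]
    field_simp
  -- `T := (1 - ε₁) D ≤ Σ_n w(p, n)` and `Λ := W/T ≤ 2 σ^r ρ`
  have hT : ∀ p ∈ primesHalf x, (1 - ε₁) * D ≤ ∑ m ∈ weightWindow c x, w p m := by
    intro p hp
    have := (abs_le.1 (h63 p hp)).1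
    linarith
  have hW0 : (0 : ℝ) ≤ (x : ℝ) ^ (1 / 3 + 1 / 100 : ℝ) := Real.rpow_nonneg hx0.le _
  have hx₁ : 0 < (x : ℝ) ^ ((1 : ℝ) / 100) := Real.rpow_pos_of_pos hx0 _
  have hτ' : ((x : ℝ) ^ ((1 : ℝ) / 100))⁻¹ ≤ τ := by
    rw [← Real.rpow_neg hx0.le]; exact hτ
  have hWx : (x : ℝ) ^ (1 / 3 + 1 / 100 : ℝ) * (x : ℝ) ^ ((1 : ℝ) / 100) *
      (x : ℝ) ^ ((1 : ℝ) / 100) = (x : ℝ) ^ (-(2 / 3 : ℝ) + 3 / 100) * x := by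
    rw [← Real.rpow_add hx0, ← Real.rpow_add hx0, ← Real.rpow_add_one hx0.ne']
    norm_num
  have hLσ' : Real.log x ^ #H ≤ (x : ℝ) ^ ((1 : ℝ) / 100) * sigmaProd (primesS x) ^ #H := by
    have h := hLσ
    rw [div_pow, div_le_iff₀ (pow_pos hσ _)] at h
    exact h
  obtain ⟨hT0, hΛ⟩ := thm4_WT_le (W := (x : ℝ) ^ (1 / 3 + 1 / 100 : ℝ))
    (ρ := (x : ℝ) ^ (-(2 / 3 : ℝ) + 3 / 100)) (T := (1 - ε₁) * D) (ε₁ := ε₁) (τ := τ)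
    (y := ySieve c x) hx0 hx₁ (pow_pos hL0 #H)
    (pow_pos hσ #H) hτ' hxy (hε₁1.trans (by norm_num)) (by rw [hDdef]) hW0 hWx hLσ'
  have hΛ0 : 0 ≤ (x : ℝ) ^ (1 / 3 + 1 / 100 : ℝ) / ((1 - ε₁) * D) := div_nonneg hW0 hT0.le
  have hρ0 : (0 : ℝ) ≤ (x : ℝ) ^ (-(2 / 3 : ℝ) + 3 / 100) := Real.rpow_nonneg hx0.le _
  have hρ1 : Real.log x ^ 20 * (x : ℝ) ^ (-(2 / 3 : ℝ) + 3 / 100) ≤ 1 :=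
    hρ.trans (Real.rpow_le_one_of_one_le_of_nonpos hx1 (by norm_num))
  -- the law `P(ñ_p = n)` and its sup bound
  have hlam0 : ∀ p n, 0 ≤ lawTilde w (weightWindow c x) p n :=
    fun p n => lawTilde_nonneg hw _ p n
  have hΛall : ∀ p n, lawTilde w (weightWindow c x) p n ≤
      (x : ℝ) ^ (1 / 3 + 1 / 100 : ℝ) / ((1 - ε₁) * D) := by
    intro p n
    by_cases hp : p ∈ primesHalf x
    · exact lawTilde_le hW0 (hWle p n) (hT p hp) hT0
    · have hz : w p n = 0 := by
        by_contra hne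
        exact hp (hsupp p n hne).1
      rw [lawTilde_eq_zero hz]
      exact hΛ0
  -- cross condition and diameter
  have hBint : ∀ p ∈ primesHalf x, 2 * (#H : ℤ) ^ 2 - 1 < p := by
    intro p hp
    have h2p : (x : ℤ) < 2 * p := by exact_mod_cast (prime_of_mem_primesHalf hp).2
    have h4 : 4 * (#H : ℤ) ^ 2 ≤ x := by exact_mod_cast h4rx
    linarith
  have hHdiff : ∀ h ∈ H, ∀ h' ∈ H, |h' - h| ≤ 2 * (#H : ℤ) ^ 2 - 1 :=
    fun h hh h' hh' => abs_sub_le_of_mem_Icc hHb hh hh'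
  have hcross := cross_prime_of_lt hPprime hBint hHdiff
  have hBcast : ((2 * (#H : ℤ) ^ 2 - 1 : ℤ) : ℝ) = 2 * (#H : ℝ) ^ 2 - 1 := by push_cast; ring
  have hM1 : (1 : ℝ) ≤ (x : ℝ) ^ 3 := one_le_pow₀ hx1
  have hMpair : ∀ q ∈ (primesQ c x).image (Nat.cast : ℕ → ℤ), ∀ i ∈ H ×ˢ primesHalf x,
      ∀ j ∈ H ×ˢ primesHalf x, ∀ m ∈ pairSet H q i, ∀ m' ∈ pairSet H q j,
      (|m - m'| : ℝ) ≤ (x : ℝ) ^ 3 := by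
    intro q _ i hi j hj m hm m' hm'
    have h := abs_sub_le_of_mem_pairSet hHdiff hi hj hm hm'
    rw [hBcast] at h
    linarith only [h, hdiam, hx0.le]
  -- the sieve distortion `δ₂ < 1`
  have hlogM : 0 ≤ Real.log ((x : ℝ) ^ 3) := Real.log_nonneg hM1
  have hs0 : 0 ≤ (sMin x : ℝ) * Real.log (sMin x) := by
    have h1 : (1 : ℝ) ≤ sMin x := by exact_mod_cast (by omega : 1 ≤ sMin x)
    exact mul_nonneg (by linarith) (Real.log_nonneg h1)
  have hδ0 : 0 ≤ (2 * (#H : ℝ)) ^ 3 * Real.log ((x : ℝ) ^ 3) / (sMin x * Real.log (sMin x)) :=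
    div_nonneg (mul_nonneg (by positivity) hlogM) hs0
  have hδ₂lt : (2 * (#H : ℝ)) ^ 3 * Real.log ((x : ℝ) ^ 3) / (sMin x * Real.log (sMin x)) < 1 := by
    have h218 : (2 : ℝ) / Real.log x ^ 18 ≤ 2 / 2 ^ 18 :=
      div_le_div_of_nonneg_left (by norm_num) (by positivity) (pow_le_pow_left₀ (by norm_num) hL2 18)
    linarith only [hδ, h218]
  -- (6.16): `A_q ≈ m`
  have hAq : ∀ q ∈ (primesQ c x).image (Nat.cast : ℕ → ℤ),
      |Alaw (primesHalf x) H (fun p n => lawTilde w (weightWindow c x) p n) q - #H * (Em / D)| ≤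
        3 * ε₁ * (#H * (Em / D)) := by
    intro q hq
    obtain ⟨q', hq', rfl⟩ := Finset.mem_image.1 hq
    exact Alaw_lawTilde_approx hD0 hEm0 hε₁0 (hε₁1.trans (by norm_num)) hw h63 (h64 q' hq')
  -- the engine
  have hE2 := boxExp_sum_sq_dev_le (S := primesS x) (P := primesHalf x) (H := H)
    (lam := fun p n => lawTilde w (weightWindow c x) p n) hS hs₀ hSs₀ hP0 hcross hlam0 hΛall hH1
    (Q := (primesQ c x).image (Nat.cast : ℕ → ℤ)) hM1 hMpair h2r hδ₂lt hm0
    (by positivity : (0 : ℝ) ≤ 3 * ε₁) hAq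
  have hnQZ : (#((primesQ c x).image (Nat.cast : ℕ → ℤ)) : ℝ) ≤
      101 / 100 * ySieve c x / Real.log x := by
    rw [Finset.card_image_of_injective _ Nat.cast_injective]; exact hnQ
  exact thm4_EF2_num (hEF := hE2) (hr := hH1) (hrL := hrL) (hσ := hσ) (hm := hmid)
    (hur0 := hur0) (hur := hur) (hu₂ := hu₂) (hε₁0 := hε₁0) (hε₁ := hε₁1) (hε₁K := hε₁K)
    (hδ0 := hδ0) (hδ := hδ) (hEe := hEe) (hΛ := hΛ) (hρ := hρ0) (hG := hρ1)
    (hnQ0 := Nat.cast_nonneg _) (hnQ := hnQZ) (hy := hy0) (hX := hx0) (hc := hc) (hσy := hσy)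
    (hL := hL2) (hL₂ := hL₂1) (hL₂L := hL₂L) (hB2a := hB2a) (hB2b := hB2b) (hB2c := hB2c)

/-- **`E F₃ ≤ 2|𝒫|σ^r/log³ x`**: the expectation over `a⃗` of the bad-prime mass
`Σ_{p ∉ 𝒫(a⃗)} X_p(a⃗)` ((6.16), engine `boxExp_badPrimes_Xp_le` with `η := 1/log³ x`).
[cite: FordGreenKonyaginMaynardTao2018, (6.13), (6.16), p. 18] -/
theorem thm4_boxExp_F3_le {c : ℝ} {x : ℕ} {H : Finset ℤ} {w : ℕ → ℤ → ℝ} {K τ : ℝ}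
    (hx1 : (1 : ℝ) ≤ x) (hL2 : 2 ≤ Real.log x) (hL₂1 : 1 ≤ Real.log (Real.log x))
    (hxy : (x : ℝ) ≤ ySieve c x)
    (hLσ : (Real.log x / sigmaProd (primesS x)) ^ #H ≤ (x : ℝ) ^ ((1 : ℝ) / 100))
    (hρ : Real.log x ^ 20 * (x : ℝ) ^ (-(2 / 3 : ℝ) + 3 / 100) ≤ (x : ℝ) ^ (-(3 / 5 : ℝ)))
    (hH1 : 1 ≤ #H) (hr2 : (#H : ℝ) ^ 2 ≤ Real.log x) (h2r : 2 * #H ≤ sMin x)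
    (hδ : (2 * (#H : ℝ)) ^ 3 * Real.log ((x : ℝ) ^ 3) / (sMin x * Real.log (sMin x)) ≤
      2 / Real.log x ^ 18)
    (hEe : 1 - 4 / Real.log x ^ 19 ≤
      Real.exp (-(2 * (#H : ℝ) ^ 2 * ∑ s ∈ primesS x, 1 / (s : ℝ) ^ 2)))
    (hHb : ∀ h ∈ H, 1 ≤ h ∧ h ≤ 2 * (#H : ℤ) ^ 2)
    (hdiam : 2 * ySieve c x + 2 * (#H : ℝ) ^ 2 * x ≤ (x : ℝ) ^ 3)
    (hK : 0 < K) (hA : 100 * K ≤ Real.log (Real.log x) ^ 10)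
    (hτ : (x : ℝ) ^ (-(1 / 100 : ℝ)) ≤ τ)
    (hw : ∀ p n, 0 ≤ w p n)
    (h63 : ∀ p ∈ primesHalf x, |∑ n ∈ weightWindow c x, w p n - τ * ySieve c x / Real.log x ^ #H|
        ≤ K / Real.log (Real.log x) ^ 10 * (τ * ySieve c x / Real.log x ^ #H))
    (hWle : ∀ p n, w p n ≤ (x : ℝ) ^ (1 / 3 + 1 / 100 : ℝ)) :
    boxExp (primesS x) (fun f => ∑ p ∈ primesHalf x,
      (if p ∈ goodPrimes x (extendRes (primesS x) f) H w (weightWindow c x)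
          (sigmaProd (primesS x) ^ #H) (1 / Real.log x ^ 3) then 0
        else Xp x (extendRes (primesS x) f) H w (weightWindow c x) p)) ≤
      2 * #(primesHalf x) * sigmaProd (primesS x) ^ #H / Real.log x ^ 3 := by
  classical
  obtain ⟨D, hDdef⟩ : ∃ D : ℝ, D = τ * ySieve c x / Real.log x ^ #H := ⟨_, rfl⟩
  obtain ⟨ε₁, hε₁def⟩ : ∃ e : ℝ, e = K / Real.log (Real.log x) ^ 10 := ⟨_, rfl⟩
  rw [← hDdef, ← hε₁def] at h63
  have hL0 : 0 < Real.log x := by linarith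
  have hL1 : 1 ≤ Real.log x := by linarith
  have hL₂0 : 0 < Real.log (Real.log x) := by linarith
  have hx0 : (0 : ℝ) < x := by linarith
  have hy0 : 0 < ySieve c x := lt_of_lt_of_le hx0 hxy
  have hS : ∀ s ∈ primesS x, s.Prime := fun s hs => prime_of_mem_primesS hs
  have hS1 : ∀ s ∈ primesS x, 1 < s := fun s hs => (hS s hs).one_lt
  have hσ : 0 < sigmaProd (primesS x) := sigmaProd_pos hS1
  have hs₀ : 2 ≤ sMin x := two_le_sMin hL1
  have hSs₀ : ∀ s ∈ primesS x, sMin x ≤ s := fun s hs => sMin_le_of_mem hs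
  have hH0 : (0 : ℝ) < #H := by exact_mod_cast hH1
  have hτ0 : 0 < τ := lt_of_lt_of_le (Real.rpow_pos_of_pos hx0 _) hτ
  have hε₁0 : 0 ≤ ε₁ := by rw [hε₁def]; positivity
  have hε₁1 : ε₁ ≤ 1 / 100 := by
    rw [hε₁def, div_le_div_iff₀ (by positivity) (by norm_num)]; linarith
  have hD0 : 0 < D := by rw [hDdef]; positivity
  -- `T` and `Λ`
  have hT : ∀ p ∈ primesHalf x, (1 - ε₁) * D ≤ ∑ m ∈ weightWindow c x, w p m := by
    intro p hp
    have := (abs_le.1 (h63 p hp)).1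
    linarith
  have hW0 : (0 : ℝ) ≤ (x : ℝ) ^ (1 / 3 + 1 / 100 : ℝ) := Real.rpow_nonneg hx0.le _
  have hx₁ : 0 < (x : ℝ) ^ ((1 : ℝ) / 100) := Real.rpow_pos_of_pos hx0 _
  have hτ' : ((x : ℝ) ^ ((1 : ℝ) / 100))⁻¹ ≤ τ := by
    rw [← Real.rpow_neg hx0.le]; exact hτ
  have hWx : (x : ℝ) ^ (1 / 3 + 1 / 100 : ℝ) * (x : ℝ) ^ ((1 : ℝ) / 100) *
      (x : ℝ) ^ ((1 : ℝ) / 100) = (x : ℝ) ^ (-(2 / 3 : ℝ) + 3 / 100) * x := by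
    rw [← Real.rpow_add hx0, ← Real.rpow_add hx0, ← Real.rpow_add_one hx0.ne']
    norm_num
  have hLσ' : Real.log x ^ #H ≤ (x : ℝ) ^ ((1 : ℝ) / 100) * sigmaProd (primesS x) ^ #H := by
    have h := hLσ
    rw [div_pow, div_le_iff₀ (pow_pos hσ _)] at h
    exact h
  obtain ⟨hT0, hΛ⟩ := thm4_WT_le (W := (x : ℝ) ^ (1 / 3 + 1 / 100 : ℝ))
    (ρ := (x : ℝ) ^ (-(2 / 3 : ℝ) + 3 / 100)) (T := (1 - ε₁) * D) (ε₁ := ε₁) (τ := τ)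
    (y := ySieve c x) hx0 hx₁ (pow_pos hL0 #H)
    (pow_pos hσ #H) hτ' hxy (hε₁1.trans (by norm_num)) (by rw [hDdef]) hW0 hWx hLσ'
  have hΛ0 : 0 ≤ (x : ℝ) ^ (1 / 3 + 1 / 100 : ℝ) / ((1 - ε₁) * D) := div_nonneg hW0 hT0.le
  have hρ0 : (0 : ℝ) ≤ (x : ℝ) ^ (-(2 / 3 : ℝ) + 3 / 100) := Real.rpow_nonneg hx0.le _
  have hρ1 : Real.log x ^ 20 * (x : ℝ) ^ (-(2 / 3 : ℝ) + 3 / 100) ≤ 1 :=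
    hρ.trans (Real.rpow_le_one_of_one_le_of_nonpos hx1 (by norm_num))
  -- diameter of the shift sets
  have hHdiff : ∀ h ∈ H, ∀ h' ∈ H, |h' - h| ≤ 2 * (#H : ℤ) ^ 2 - 1 :=
    fun h hh h' hh' => abs_sub_le_of_mem_Icc hHb hh hh'
  have hBcast : ((2 * (#H : ℤ) ^ 2 - 1 : ℤ) : ℝ) = 2 * (#H : ℝ) ^ 2 - 1 := by push_cast; ring
  have hM1 : (1 : ℝ) ≤ (x : ℝ) ^ 3 := one_le_pow₀ hx1
  have hMshift : ∀ p ∈ primesHalf x, ∀ n ∈ weightWindow c x, ∀ n' ∈ weightWindow c x,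
      ∀ h ∈ H, ∀ h' ∈ H,
      |((n + h * (p : ℤ) : ℤ) : ℝ) - ((n' + h' * (p : ℤ) : ℤ) : ℝ)| ≤ (x : ℝ) ^ 3 := by
    intro p hp n hn n' hn' h hh h' hh'
    have h := abs_sub_le_of_mem_shiftSet hy0.le hHdiff hp hn hn' hh hh'
    rw [hBcast] at h
    linarith only [h, hdiam, hx0.le]
  -- the sieve distortions
  have hlogM : 0 ≤ Real.log ((x : ℝ) ^ 3) := Real.log_nonneg hM1
  have hs0 : 0 ≤ (sMin x : ℝ) * Real.log (sMin x) := by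
    have h1 : (1 : ℝ) ≤ sMin x := by exact_mod_cast (by omega : 1 ≤ sMin x)
    exact mul_nonneg (by linarith) (Real.log_nonneg h1)
  have hδ₂lt : (2 * (#H : ℝ)) ^ 3 * Real.log ((x : ℝ) ^ 3) / (sMin x * Real.log (sMin x)) < 1 := by
    have h218 : (2 : ℝ) / Real.log x ^ 18 ≤ 2 / 2 ^ 18 :=
      div_le_div_of_nonneg_left (by norm_num) (by positivity) (pow_le_pow_left₀ (by norm_num) hL2 18)
    linarith only [hδ, h218]
  have hδ₁le : (#H : ℝ) ^ 3 * Real.log ((x : ℝ) ^ 3) / (sMin x * Real.log (sMin x)) ≤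
      (2 * (#H : ℝ)) ^ 3 * Real.log ((x : ℝ) ^ 3) / (sMin x * Real.log (sMin x)) := by
    refine div_le_div_of_nonneg_right (mul_le_mul_of_nonneg_right ?_ hlogM) hs0
    exact pow_le_pow_left₀ hH0.le (by linarith) 3
  have hδ₁0 : 0 ≤ (#H : ℝ) ^ 3 * Real.log ((x : ℝ) ^ 3) / (sMin x * Real.log (sMin x)) :=
    div_nonneg (mul_nonneg (by positivity) hlogM) hs0
  have hEe1 : Real.exp (-(2 * (#H : ℝ) ^ 2 * ∑ s ∈ primesS x, 1 / (s : ℝ) ^ 2)) ≤ 1 :=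
    Real.exp_le_one_iff.2 (neg_nonpos.2 (by positivity))
  -- the engine
  have hη0 : (0 : ℝ) < 1 / Real.log x ^ 3 := by positivity
  have hη1 : 1 / Real.log x ^ 3 ≤ 1 := by
    rw [div_le_one (by positivity)]; exact one_le_pow₀ hL1
  have hE3 := boxExp_badPrimes_Xp_le (H := H) (N := weightWindow c x) hS hs₀ hSs₀ hw hW0 hWle hT
    hT0 hM1 hMshift h2r hδ₂lt hη0 hη1
  exact thm4_EF3_num (hEF := hE3) (hnP := Nat.cast_nonneg _) (hσr := pow_pos hσ _)
    (hδ₁0 := hδ₁0) (hδ₁₂ := hδ₁le) (hδ₂ := hδ) (hEe := hEe) (hEe1 := hEe1) (hΛ0 := hΛ0)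
    (hΛ := hΛ) (hρ := hρ0) (hG := hρ1) (hrr := hr2) (hη := rfl) (hL := hL2)

/-- **A good `a⃗` exists.** At a large `x`, given the sieve weight of Theorem 5 for `H`, some
residue vector `a⃗` has (4.5)′ `#(𝒬 ∩ S(a⃗)) < 100 c x log₂ x/log x`, second-moment sum
`< σ^{2r} x/(32 log x log₂⁵ x)` and bad-prime mass `< 40(|𝒫|+1)σ^r/log³ x`
(Markov over the three bad events with budgets `0.82 + 0.01 + 0.05 < 1`).
[cite: FordGreenKonyaginMaynardTao2018, §6 p. 18: Cor. 4, Lemma 6.2, (6.16), (6.17)] -/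
theorem thm4_exists_good {c : ℝ} {x : ℕ} {H : Finset ℤ} {w : ℕ → ℤ → ℝ} {K τ u₂ ur : ℝ}
    (hc : 0 < c) (hx1 : (1 : ℝ) ≤ x)
    (hL2 : 2 ≤ Real.log x) (hL₂1 : 1 ≤ Real.log (Real.log x))
    (hxy : (x : ℝ) ≤ ySieve c x)
    (hLσ : (Real.log x / sigmaProd (primesS x)) ^ #H ≤ (x : ℝ) ^ ((1 : ℝ) / 100))
    (hρ : Real.log x ^ 20 * (x : ℝ) ^ (-(2 / 3 : ℝ) + 3 / 100) ≤ (x : ℝ) ^ (-(3 / 5 : ℝ)))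
    (hσy : 99 / 100 * (80 * c * x * Real.log (Real.log x)) ≤ sigmaProd (primesS x) * ySieve c x)
    (hnQ : (#(primesQ c x) : ℝ) ≤ 101 / 100 * ySieve c x / Real.log x)
    (hB1 : boxExp (primesS x) (fun f => (#(sievedQ c x (extendRes (primesS x) f)) : ℝ)) ≤
      82 * c * x * Real.log (Real.log x) / Real.log x)
    (hH1 : 1 ≤ #H) (hrL : (#H : ℝ) ≤ Real.log x) (hr2 : (#H : ℝ) ^ 2 ≤ Real.log x)
    (h2r : 2 * #H ≤ sMin x)
    (hδ : (2 * (#H : ℝ)) ^ 3 * Real.log ((x : ℝ) ^ 3) / (sMin x * Real.log (sMin x)) ≤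
      2 / Real.log x ^ 18)
    (hEe : 1 - 4 / Real.log x ^ 19 ≤
      Real.exp (-(2 * (#H : ℝ) ^ 2 * ∑ s ∈ primesS x, 1 / (s : ℝ) ^ 2)))
    (hHb : ∀ h ∈ H, 1 ≤ h ∧ h ≤ 2 * (#H : ℤ) ^ 2)
    (hdiam : 2 * ySieve c x + 2 * (#H : ℝ) ^ 2 * x ≤ (x : ℝ) ^ 3 ∧
      4 * (#H : ℝ) ^ 2 * x ≤ (x : ℝ) ^ 3)
    (h4rx : 4 * (#H : ℝ) ^ 2 ≤ x)
    (hK : 0 < K) (hu₂ : 0 ≤ u₂) (hur0 : 0 ≤ ur) (hur : ur ≤ u₂ * Real.log (Real.log x) / 5)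
    (hA : 100 * K ≤ Real.log (Real.log x) ^ 10)
    (hB2a : 30 * K * u₂ ^ 2 / c ≤ Real.log (Real.log x) ^ 4)
    (hB2b : 32 * u₂ ^ 2 / c ≤ Real.log x) (hB2c : 3879 * u₂ ≤ Real.log x)
    (hτ : (x : ℝ) ^ (-(1 / 100 : ℝ)) ≤ τ)
    (hw : ∀ p n, 0 ≤ w p n)
    (hsupp : ∀ p n, w p n ≠ 0 → p ∈ primesHalf x ∧ |(n : ℝ)| ≤ ySieve c x)
    (h63 : ∀ p ∈ primesHalf x, |∑ n ∈ weightWindow c x, w p n - τ * ySieve c x / Real.log x ^ #H|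
        ≤ K / Real.log (Real.log x) ^ 10 * (τ * ySieve c x / Real.log x ^ #H))
    (h64 : ∀ q ∈ primesQ c x, ∀ h ∈ H, |∑ p ∈ primesHalf x, w p ((q : ℤ) - h * p)
          - τ * (ur / #H) * ((x : ℝ) / (2 * Real.log x ^ #H))|
        ≤ K / Real.log (Real.log x) ^ 10 * (τ * (ur / #H) * ((x : ℝ) / (2 * Real.log x ^ #H))))
    (hWle : ∀ p n, w p n ≤ (x : ℝ) ^ (1 / 3 + 1 / 100 : ℝ)) :
    ∃ f ∈ residueBox (primesS x),
      (#(sievedQ c x (extendRes (primesS x) f)) : ℝ) <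
          100 * c * ((x : ℝ) * Real.log (Real.log x) / Real.log x) ∧
      (∑ q ∈ (primesQ c x).image (Nat.cast : ℕ → ℤ), siftInd (primesS x) {q} f *
          (Ylaw (primesS x) (primesHalf x) H (fun p n => lawTilde w (weightWindow c x) p n) f q -
            sigmaProd (primesS x) ^ (#H - 1) *
              (#H * (τ * (ur / #H) * ((x : ℝ) / (2 * Real.log x ^ #H)) /
                (τ * ySieve c x / Real.log x ^ #H)))) ^ 2) <
        sigmaProd (primesS x) ^ (2 * #H) * x / (32 * Real.log x * Real.log (Real.log x) ^ 5) ∧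
      (∑ p ∈ primesHalf x,
          (if p ∈ goodPrimes x (extendRes (primesS x) f) H w (weightWindow c x)
              (sigmaProd (primesS x) ^ #H) (1 / Real.log x ^ 3) then 0
          else Xp x (extendRes (primesS x) f) H w (weightWindow c x) p)) <
        40 * ((#(primesHalf x) : ℝ) + 1) * sigmaProd (primesS x) ^ #H / Real.log x ^ 3 := by
  classical
  have hL0 : 0 < Real.log x := by linarith
  have hL₂0 : 0 < Real.log (Real.log x) := by linarith
  have hx0 : (0 : ℝ) < x := by linarith
  have hS : ∀ s ∈ primesS x, s.Prime := fun s hs => prime_of_mem_primesS hs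
  have hS0 : ∀ s ∈ primesS x, 0 < s := fun s hs => (hS s hs).pos
  have hS1 : ∀ s ∈ primesS x, 1 < s := fun s hs => (hS s hs).one_lt
  have hσ : 0 < sigmaProd (primesS x) := sigmaProd_pos hS1
  have hF2 := thm4_boxExp_F2_le hc hx1 hL2 hL₂1 hxy hLσ hρ hσy hnQ hH1 hrL h2r hδ hEe hHb hdiam.2
    h4rx hK hu₂ hur0 hur hA hB2a hB2b hB2c hτ hw hsupp h63 h64 hWle
  have hF3 := thm4_boxExp_F3_le hx1 hL2 hL₂1 hxy hLσ hρ hH1 hr2 h2r hδ hEe hHb hdiam.1 hK hA hτ hw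
    h63 hWle
  -- Markov
  have ht₁ : (0 : ℝ) < 100 * c * ((x : ℝ) * Real.log (Real.log x) / Real.log x) := by positivity
  have ht₂ : (0 : ℝ) < sigmaProd (primesS x) ^ (2 * #H) * x /
      (32 * Real.log x * Real.log (Real.log x) ^ 5) := by positivity
  have ht₃ : (0 : ℝ) < 40 * ((#(primesHalf x) : ℝ) + 1) * sigmaProd (primesS x) ^ #H /
      Real.log x ^ 3 := by positivity
  refine exists_good_of_markov3 hS0 (fun f _ => Nat.cast_nonneg _)
    (fun f _ => Finset.sum_nonneg fun q _ => mul_nonneg (siftInd_nonneg _ _ f) (sq_nonneg _))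
    (fun f _ => Finset.sum_nonneg fun p _ => ?_) ht₁ ht₂ ht₃ ?_
  · split_ifs
    · exact le_rfl
    · exact Xp_nonneg hw p
  have q1 : boxExp (primesS x) (fun f => (#(sievedQ c x (extendRes (primesS x) f)) : ℝ)) /
      (100 * c * ((x : ℝ) * Real.log (Real.log x) / Real.log x)) ≤ 82 / 100 := by
    rw [div_le_iff₀ ht₁]
    exact hB1.trans (le_of_eq (by field_simp))
  have q2 : boxExp (primesS x) (fun f => ∑ q ∈ (primesQ c x).image (Nat.cast : ℕ → ℤ),
      siftInd (primesS x) {q} f *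
        (Ylaw (primesS x) (primesHalf x) H (fun p n => lawTilde w (weightWindow c x) p n) f q -
          sigmaProd (primesS x) ^ (#H - 1) *
            (#H * (τ * (ur / #H) * ((x : ℝ) / (2 * Real.log x ^ #H)) /
              (τ * ySieve c x / Real.log x ^ #H)))) ^ 2) /
      (sigmaProd (primesS x) ^ (2 * #H) * x / (32 * Real.log x * Real.log (Real.log x) ^ 5)) ≤
      1 / 100 := by
    rw [div_le_iff₀ ht₂]
    exact hF2.trans (le_of_eq (by ring))
  have q3 : boxExp (primesS x) (fun f => ∑ p ∈ primesHalf x,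
      (if p ∈ goodPrimes x (extendRes (primesS x) f) H w (weightWindow c x)
          (sigmaProd (primesS x) ^ #H) (1 / Real.log x ^ 3) then 0
        else Xp x (extendRes (primesS x) f) H w (weightWindow c x) p)) /
      (40 * ((#(primesHalf x) : ℝ) + 1) * sigmaProd (primesS x) ^ #H / Real.log x ^ 3) ≤
      1 / 20 := by
    rw [div_le_iff₀ ht₃]
    refine hF3.trans ?_
    have hσr := pow_pos hσ #H
    rw [show 1 / 20 * (40 * ((#(primesHalf x) : ℝ) + 1) * sigmaProd (primesS x) ^ #H /
        Real.log x ^ 3) = 2 * ((#(primesHalf x) : ℝ) + 1) * sigmaProd (primesS x) ^ #H /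
        Real.log x ^ 3 by ring]
    refine div_le_div_of_nonneg_right ?_ (by positivity)
    linarith only [hσr]
  linarith only [q1, q2, q3]

/-! ### §6. Theorem 4 at a large `x` from a good residue vector -/

/-- **Theorem 4 at `x` from a good `a⃗`** (§6 p. 18): with `ν := ` the conditional law
`P(n_p = n | a⃗)` of (6.10)–(6.11) for good `p` and `n_p = 0` otherwise, `C := m/σ ∈ [u₁/(2000c), u₂/(700c)]`,
and the exceptional set `E := E₂ ∪ E₃` (`#E ≤ x/(log x log₂ x)`), the data of Theorem 4 at `x`:
laws ((6.10)), sparsity (4.6)′ (from (6.7)), size (4.5)′, and the uniform covering (6.14).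
[cite: FordGreenKonyaginMaynardTao2018, §6 pp. 17–18, deduction of Thm 4 from Thm 5] -/
theorem thm4_of_good {c : ℝ} {x : ℕ} {H : Finset ℤ} {w : ℕ → ℤ → ℝ} {K τ u₁ u₂ ur : ℝ}
    (hc : 0 < c) (hx1 : (1 : ℝ) ≤ x)
    (hL2 : 2 ≤ Real.log x) (hL₂1 : 1 ≤ Real.log (Real.log x))
    (h81 : 81 * Real.log (Real.log x) ^ 2 ≤ Real.log x)
    (h200 : 200 * ((#H : ℝ) * Real.log (Real.log x)) ≤ Real.log x)
    (hxy : (x : ℝ) ≤ ySieve c x)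
    (hLσ : (Real.log x / sigmaProd (primesS x)) ^ #H ≤ (x : ℝ) ^ ((1 : ℝ) / 100))
    (hρ : Real.log x ^ 20 * (x : ℝ) ^ (-(2 / 3 : ℝ) + 3 / 100) ≤ (x : ℝ) ^ (-(3 / 5 : ℝ)))
    (hσy : 99 / 100 * (80 * c * x * Real.log (Real.log x)) ≤ sigmaProd (primesS x) * ySieve c x ∧
      sigmaProd (primesS x) * ySieve c x ≤ 101 / 100 * (80 * c * x * Real.log (Real.log x)))
    (hH1 : 1 ≤ #H) (hrL : (#H : ℝ) ≤ Real.log x) (hHsqrt : (#H : ℝ) ≤ Real.sqrt (Real.log x))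
    (hlr : Real.log (Real.log x) / 10 ≤ Real.log (#H : ℝ) ∧
      Real.log (#H : ℝ) ≤ Real.log (Real.log x) / 5)
    (hu₁ : 0 < u₁) (hur₁ : u₁ * Real.log (#H : ℝ) ≤ ur) (hur₂ : ur ≤ u₂ * Real.log (#H : ℝ))
    (hfin : u₂ / 700 / c + 1 ≤ Real.log x)
    (hK : 0 < K) (hA : 100 * K ≤ Real.log (Real.log x) ^ 10)
    (hτ : (x : ℝ) ^ (-(1 / 100 : ℝ)) ≤ τ)
    (hw : ∀ p n, 0 ≤ w p n)
    (hsupp : ∀ p n, w p n ≠ 0 → p ∈ primesHalf x ∧ |(n : ℝ)| ≤ ySieve c x)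
    (h63 : ∀ p ∈ primesHalf x, |∑ n ∈ weightWindow c x, w p n - τ * ySieve c x / Real.log x ^ #H|
        ≤ K / Real.log (Real.log x) ^ 10 * (τ * ySieve c x / Real.log x ^ #H))
    (hWle : ∀ p n, w p n ≤ (x : ℝ) ^ (1 / 3 + 1 / 100 : ℝ))
    (f : (s : ℕ) → s ∈ primesS x → ℕ)
    (hF1 : (#(sievedQ c x (extendRes (primesS x) f)) : ℝ) <
      100 * c * ((x : ℝ) * Real.log (Real.log x) / Real.log x))
    (hF2 : ∑ q ∈ (primesQ c x).image (Nat.cast : ℕ → ℤ), siftInd (primesS x) {q} f *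
          (Ylaw (primesS x) (primesHalf x) H (fun p n => lawTilde w (weightWindow c x) p n) f q -
            sigmaProd (primesS x) ^ (#H - 1) *
              (#H * (τ * (ur / #H) * ((x : ℝ) / (2 * Real.log x ^ #H)) /
                (τ * ySieve c x / Real.log x ^ #H)))) ^ 2 <
        sigmaProd (primesS x) ^ (2 * #H) * x / (32 * Real.log x * Real.log (Real.log x) ^ 5))
    (hF3 : ∑ p ∈ primesHalf x,
          (if p ∈ goodPrimes x (extendRes (primesS x) f) H w (weightWindow c x)
              (sigmaProd (primesS x) ^ #H) (1 / Real.log x ^ 3) then 0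
          else Xp x (extendRes (primesS x) f) H w (weightWindow c x) p) <
        40 * ((#(primesHalf x) : ℝ) + 1) * sigmaProd (primesS x) ^ #H / Real.log x ^ 3) :
    ∃ C : ℝ, u₁ / 2000 / c ≤ C ∧ C ≤ u₂ / 700 / c ∧
      ∃ (H' : Finset ℤ) (a : ℕ → ℕ) (N : Finset ℤ) (ν : ℕ → ℤ → ℝ),
        (H'.card : ℝ) ≤ Real.sqrt (Real.log x) ∧
        (∀ p ∈ primesHalf x, (∀ n, 0 ≤ ν p n) ∧ (∀ n, n ∉ N → ν p n = 0) ∧ ∑ n ∈ N, ν p n = 1) ∧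
        (∀ p ∈ primesHalf x, ∀ q ∈ sievedQ c x a,
          probInEdge c x a H' N ν p q ≤ (x : ℝ) ^ (-(3 / 5 : ℝ))) ∧
        ((#(sievedQ c x a) : ℝ) ≤ 100 * c * ((x : ℝ) * Real.log (Real.log x) / Real.log x)) ∧
        ∃ E : Finset ℕ, E ⊆ sievedQ c x a ∧
          (#E : ℝ) ≤ (x : ℝ) / (Real.log x * Real.log (Real.log x)) ∧
          ∀ q ∈ sievedQ c x a, q ∉ E →
            |∑ p ∈ primesHalf x, probInEdge c x a H' N ν p q - C| ≤
              1 / Real.log (Real.log x) ^ 2 := by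
  classical
  obtain ⟨D, hDdef⟩ : ∃ D : ℝ, D = τ * ySieve c x / Real.log x ^ #H := ⟨_, rfl⟩
  obtain ⟨Em, hEmdef⟩ : ∃ E : ℝ, E = τ * (ur / #H) * ((x : ℝ) / (2 * Real.log x ^ #H)) :=
    ⟨_, rfl⟩
  obtain ⟨ε₁, hε₁def⟩ : ∃ e : ℝ, e = K / Real.log (Real.log x) ^ 10 := ⟨_, rfl⟩
  rw [← hDdef, ← hEmdef] at hF2
  rw [← hDdef, ← hε₁def] at h63
  -- positivity bookkeeping
  have hL0 : 0 < Real.log x := by linarith only [hL2]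
  have hL1 : 1 ≤ Real.log x := by linarith only [hL2]
  have hL₂0 : 0 < Real.log (Real.log x) := by linarith only [hL₂1]
  have hx0 : (0 : ℝ) < x := by linarith only [hx1]
  have hy0 : 0 < ySieve c x := lt_of_lt_of_le hx0 hxy
  have hur0 : 0 ≤ ur :=
    le_trans (mul_nonneg hu₁.le (le_trans (by positivity) hlr.1)) hur₁
  have hS : ∀ s ∈ primesS x, s.Prime := fun s hs => prime_of_mem_primesS hs
  have hS1 : ∀ s ∈ primesS x, 1 < s := fun s hs => (hS s hs).one_lt
  have hσ : 0 < sigmaProd (primesS x) := sigmaProd_pos hS1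
  have hX₀ : 0 < sigmaProd (primesS x) ^ #H := pow_pos hσ _
  have hH0 : (0 : ℝ) < #H := by exact_mod_cast hH1
  have hwN : ∀ p n, n ∉ weightWindow c x → w p n = 0 :=
    thm4_weight_eq_zero_off_window hy0.le hsupp
  have hτ0 : 0 < τ := lt_of_lt_of_le (Real.rpow_pos_of_pos hx0 _) hτ
  have hε₁0 : 0 ≤ ε₁ := by rw [hε₁def]; positivity
  have hε₁1 : ε₁ ≤ 1 / 100 := by
    rw [hε₁def, div_le_div_iff₀ (by positivity) (by norm_num)]; linarith only [hA]
  have hD0 : 0 < D := by rw [hDdef]; positivity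
  have hEm0 : 0 ≤ Em := by rw [hEmdef]; positivity
  have hm0 : (0 : ℝ) ≤ #H * (Em / D) := by positivity
  have hmid : #H * (Em / D) = ur * x / (2 * ySieve c x) := by
    rw [hEmdef, hDdef]
    field_simp
  -- `T` and `Λ`
  have hT : ∀ p ∈ primesHalf x, (1 - ε₁) * D ≤ ∑ m ∈ weightWindow c x, w p m := by
    intro p hp
    have := (abs_le.1 (h63 p hp)).1
    linarith only [this]
  have hW0 : (0 : ℝ) ≤ (x : ℝ) ^ (1 / 3 + 1 / 100 : ℝ) := Real.rpow_nonneg hx0.le _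
  have hx₁ : 0 < (x : ℝ) ^ ((1 : ℝ) / 100) := Real.rpow_pos_of_pos hx0 _
  have hτ' : ((x : ℝ) ^ ((1 : ℝ) / 100))⁻¹ ≤ τ := by
    rw [← Real.rpow_neg hx0.le]; exact hτ
  have hWx : (x : ℝ) ^ (1 / 3 + 1 / 100 : ℝ) * (x : ℝ) ^ ((1 : ℝ) / 100) *
      (x : ℝ) ^ ((1 : ℝ) / 100) = (x : ℝ) ^ (-(2 / 3 : ℝ) + 3 / 100) * x := by
    rw [← Real.rpow_add hx0, ← Real.rpow_add hx0, ← Real.rpow_add_one hx0.ne']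
    norm_num
  have hLσ' : Real.log x ^ #H ≤ (x : ℝ) ^ ((1 : ℝ) / 100) * sigmaProd (primesS x) ^ #H := by
    have h := hLσ
    rw [div_pow, div_le_iff₀ (pow_pos hσ _)] at h
    exact h
  obtain ⟨hT0, hΛ⟩ := thm4_WT_le (W := (x : ℝ) ^ (1 / 3 + 1 / 100 : ℝ))
    (ρ := (x : ℝ) ^ (-(2 / 3 : ℝ) + 3 / 100)) (T := (1 - ε₁) * D) (ε₁ := ε₁) (τ := τ)
    (y := ySieve c x) hx0 hx₁ (pow_pos hL0 #H)
    (pow_pos hσ #H) hτ' hxy (hε₁1.trans (by norm_num)) (by rw [hDdef]) hW0 hWx hLσ'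
  have hΛ0 : 0 ≤ (x : ℝ) ^ (1 / 3 + 1 / 100 : ℝ) / ((1 - ε₁) * D) := div_nonneg hW0 hT0.le
  have hρ0 : (0 : ℝ) ≤ (x : ℝ) ^ (-(2 / 3 : ℝ) + 3 / 100) := Real.rpow_nonneg hx0.le _
  -- `η := 1/log³ x`
  have hη2 : 1 / Real.log x ^ 3 ≤ 1 / 2 :=
    div_le_div_of_nonneg_left (by norm_num) (by norm_num)
      (le_trans (by norm_num : (2 : ℝ) ≤ 2 ^ 3) (pow_le_pow_left₀ (by norm_num) hL2 3))
  have hη1 : 1 / Real.log x ^ 3 < 1 := by linarith only [hη2]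
  -- the constant `C = m/σ`
  have hCb := thm4_C_bounds (L₂ := Real.log (Real.log x)) hc hx0 hy0 hσ hmid hu₁ hur₁ hur₂ hlr.1
    hlr.2 hL₂0 hσy.1 hσy.2
  have hfin' : 4 * Real.log (Real.log x) ^ 2 * (#H * (Em / D) / sigmaProd (primesS x) + 1) ≤
      Real.log x ^ 3 := by
    have h1 : #H * (Em / D) / sigmaProd (primesS x) + 1 ≤ Real.log x := by
      linarith only [hCb.2, hfin]
    have h2 : (0 : ℝ) ≤ #H * (Em / D) / sigmaProd (primesS x) + 1 := by positivity
    have h3 : 4 * Real.log (Real.log x) ^ 2 ≤ Real.log x := by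
      linarith only [h81, sq_nonneg (Real.log (Real.log x))]
    calc 4 * Real.log (Real.log x) ^ 2 * (#H * (Em / D) / sigmaProd (primesS x) + 1)
        ≤ Real.log x * Real.log x := mul_le_mul h3 h1 h2 hL0.le
      _ = Real.log x * Real.log x * 1 := by ring
      _ ≤ Real.log x * Real.log x * Real.log x :=
          mul_le_mul_of_nonneg_left hL1 (by positivity)
      _ = Real.log x ^ 3 := by ring
  refine ⟨#H * (Em / D) / sigmaProd (primesS x), hCb.1, hCb.2, H, extendRes (primesS x) f,
    weightWindow c x, condLaw x (extendRes (primesS x) f) H w (weightWindow c x)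
      (sigmaProd (primesS x) ^ #H) (1 / Real.log x ^ 3), hHsqrt, ?_, ?_, hF1.le, ?_⟩
  · intro p _
    exact condLaw_isLaw hw hwN (zero_mem_weightWindow c x) hX₀ hη1 p
  · intro p hp q hq
    refine (probInEdge_condLaw_le hw hwN (zero_mem_weightWindow c x) hX₀ hη1 hp hq
      (fun n => hWle p n) (hT p hp) hT0).trans ?_
    exact thm4_sparsity_num hΛ0 hΛ (pow_pos hσ _) hη2 hrL hL2 hρ0 hρ
  · refine ⟨_, ?_, thm4_card_E_le f hw hwN hx1 hL2 hL₂1 h81 h200 hσ hF2 hF3, ?_⟩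
    · exact Finset.union_subset (Finset.filter_subset _ _) (Finset.filter_subset _ _)
    · intro q hq hqE
      rw [Finset.mem_union, not_or, Finset.mem_filter, Finset.mem_filter, not_and, not_and] at hqE
      exact thm4_goodness hw hwN (zero_mem_weightWindow c x) hH1 hσ hm0 hL0 hL₂1 hη2 hfin' hq
        (not_le.1 (hqE.1 hq)) (not_lt.1 (hqE.2 hq))

end FGKMT2018

open FGKMT2018

/-! ### §7. Theorem 4 from Theorem 5, and the corollaries -/

/-- **FGKMT Theorem 4 from Theorem 5** (the deduction of §6, pp. 17–19): the random
construction (in the finite form `FordGreenKonyaginMaynardTao2018_theorem4` with `x^{-3/5}`)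
follows from the existence of the sieve weight `w(p, n)` of Theorem 5, with
`r = ⌊log^{1/5} x⌋` admissible square shifts, a good residue vector `a⃗` chosen by Markov's
inequality over the three bad events ((4.5)′, (6.17), the bad-prime part of (6.15)), and
`n_p` drawn from the conditional law `Z_p(a⃗; n)/X_p(a⃗)` ((6.10)–(6.11)).
[cite: FordGreenKonyaginMaynardTao2018, §6 pp. 17–19: Thm 4 (p. 13) from Thm 5 (p. 17)] -/
theorem fgkmt2018_theorem4_of_theorem5 :
    FordGreenKonyaginMaynardTao2018_theorem5 → FordGreenKonyaginMaynardTao2018_theorem4 := by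
  classical
  rintro ⟨u, r₀, u₁, u₂, hu₁, hu₁₂, hu, h5⟩
  have hu₂ : 0 ≤ u₂ := by linarith
  refine ⟨u₁ / 2000, u₂ / 700, by positivity, by linarith, fun c hc hc1 => ?_⟩
  obtain ⟨K, hK, h5x⟩ := h5 c hc hc1 1 one_pos (1 / 100) (by norm_num)
  have hℓ₂ : Tendsto (fun x : ℕ => Real.log (Real.log x)) atTop atTop :=
    Real.tendsto_log_atTop.comp (Real.tendsto_log_atTop.comp tendsto_natCast_atTop_atTop)
  filter_upwards [h5x, params_growth, inv_log_le_sigma, log_div_sigma_pow_le,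
    log_shiftCount_bounds, le_ySieve hc, card_primesQ_le hc, boxExp_card_sievedQ_le hc,
    sigma_mul_ySieve_asymp (show (0 : ℝ) < 1 / 100 by norm_num), diam_le_cube,
    eventually_le_shiftCount r₀, thm4_rpow_growth,
    hℓ₂.eventually_ge_atTop (100 * K + 30 * K * u₂ ^ 2 / c + 32 * u₂ ^ 2 / c + 3879 * u₂ +
      (u₂ / 700 / c + 1))] with x h5 hg hσL hLσ hlr hxy hnQ hB1 hσy hdiam hr₀ hρ hA0
  obtain ⟨h1, h2, -, h81, hLx, h200, h2r5, h7⟩ := hg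
  -- `log^[2] = log log`
  rw [thm4_iter_two] at h5 hσy ⊢
  have hL0 : 0 < Real.log x := by linarith
  have hL1 : 1 ≤ Real.log x := by linarith
  have hx1 : (1 : ℝ) ≤ x := (thm4_one_lt_of_log hL1).le
  have hL₂0 : 0 < Real.log (Real.log x) := by linarith
  have hL₂L : Real.log (Real.log x) ≤ Real.log x :=
    (Real.log_le_sub_one_of_pos hL0).trans (by linarith)
  -- the tuple `H = sqShifts r`, `r = ⌊log^{1/5} x⌋`
  obtain ⟨H, hHdef⟩ : ∃ H : Finset ℤ, H = sqShifts (shiftCount x) := ⟨_, rfl⟩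
  have hHc : #H = shiftCount x := by rw [hHdef]; exact card_sqShifts _
  have hspec := sqShifts_shiftCount_spec x
  rw [← hHdef] at hspec
  obtain ⟨hadm, hH5, hHb⟩ := hspec
  rw [← hHc] at hLσ hlr hdiam hr₀
  have hdiam' := hdiam c hc hc1
  have hH2 : 2 ≤ #H := by
    rw [hHc]
    exact Nat.le_floor (by exact_mod_cast h2r5)
  have hH1 : 1 ≤ #H := le_trans (by norm_num) hH2
  have hrL : (#H : ℝ) ≤ Real.log x := by rw [hHc]; exact shiftCount_le_log hL1
  have hr2 : (#H : ℝ) ^ 2 ≤ Real.log x := by rw [hHc]; exact shiftCount_sq_le hL1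
  have hHsqrt : (#H : ℝ) ≤ Real.sqrt (Real.log x) := by rw [hHc]; exact shiftCount_le_sqrt hL1
  have h2rS : 2 * #H ≤ sMin x := by rw [hHc]; exact two_mul_shiftCount_le_sMin h1
  have hδ := delta_le hL1 h2
  rw [← hHc] at hδ
  have hEe := (exp_shift_ge (x := x) hL1).2
  rw [← hHc] at hEe
  have h4L : 4 * Real.log x ≤ x := by
    have h8 : 8 ≤ Real.log x := by
      have he := Real.add_one_le_exp (7 : ℝ)
      have h' : Real.exp 7 ≤ Real.log x := by
        have := Real.exp_le_exp.2 h7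
        rwa [Real.exp_log hL0] at this
      linarith
    nlinarith [hLx]
  have h4rx : 4 * (#H : ℝ) ^ 2 ≤ x := by rw [hHc]; exact four_mul_sq_shiftCount_le hL1 h4L
  have h200H : 200 * ((#H : ℝ) * Real.log (Real.log x)) ≤ Real.log x :=
    le_trans (mul_le_mul_of_nonneg_left (mul_le_mul_of_nonneg_right hH5 hL₂0.le) (by norm_num))
      h200
  -- `σ` as `sigmaProd 𝒮`
  rw [sigma_eq_sigmaProd] at hσL hLσ hσy
  have hσy' : 99 / 100 * (80 * c * x * Real.log (Real.log x)) ≤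
        sigmaProd (primesS x) * ySieve c x ∧
      sigmaProd (primesS x) * ySieve c x ≤ 101 / 100 * (80 * c * x * Real.log (Real.log x)) := by
    have h := hσy c hc
    constructor
    · linarith [h.1]
    · linarith [h.2]
  -- the sieve weight of Theorem 5 for `H`
  obtain ⟨τ, hτ, w, hw, hsupp, h63, h64, -, hWle⟩ := h5 H hadm hr₀ hH5 hHb
  -- the constants at `x`
  have hur := hu (#H) hr₀
  have hlogH0 : 0 ≤ Real.log (#H : ℝ) := le_trans (by positivity) hlr.1
  have hur0 : 0 ≤ u #H := le_trans (mul_nonneg hu₁.le hlogH0) hur.1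
  have hur5 : u #H ≤ u₂ * Real.log (Real.log x) / 5 := by
    have := mul_le_mul_of_nonneg_left hlr.2 hu₂
    linarith [hur.2]
  have hs1 : 0 ≤ 30 * K * u₂ ^ 2 / c := by positivity
  have hs2 : 0 ≤ 32 * u₂ ^ 2 / c := by positivity
  have hs3 : 0 ≤ u₂ / 700 / c := by positivity
  have hL₂p4 : Real.log (Real.log x) ≤ Real.log (Real.log x) ^ 4 := le_self_pow₀ h2 (by norm_num)
  have hL₂p10 : Real.log (Real.log x) ≤ Real.log (Real.log x) ^ 10 :=
    le_self_pow₀ h2 (by norm_num)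
  have hA : 100 * K ≤ Real.log (Real.log x) ^ 10 := by linarith
  have hB2a : 30 * K * u₂ ^ 2 / c ≤ Real.log (Real.log x) ^ 4 := by linarith
  have hB2b : 32 * u₂ ^ 2 / c ≤ Real.log x := by linarith
  have hB2c : 3879 * u₂ ≤ Real.log x := by linarith
  have hfin : u₂ / 700 / c + 1 ≤ Real.log x := by linarith
  -- a good residue vector, and the conclusion
  obtain ⟨f, -, hF1, hF2, hF3⟩ := thm4_exists_good (ur := u #H) hc hx1 h1 h2 hxy hLσ hρ hσy'.1
    hnQ hB1 hH1 hrL hr2 h2rS hδ hEe hHb hdiam' h4rx hK hu₂ hur0 hur5 hA hB2a hB2b hB2c hτ hw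
    hsupp h63 h64 hWle
  exact thm4_of_good hc hx1 h1 h2 h81 h200H hxy hLσ hρ hσy' hH1 hrL hHsqrt hlr hu₁ hur.1 hur.2
    hfin hK hA hτ hw hsupp h63 hWle f hF1 hF2 hF3

/-- **FGKMT Theorem 2 from Theorems 3 and 5** (the paper's chain §4.3 + §6):
sieving primes Theorem 2 follows from the covering Theorem 3 and the weight Theorem 5.
[cite: FordGreenKonyaginMaynardTao2018, Thm 2 from Thm 3 (§5) + Thm 5 (§§6–7)] -/
theorem fgkmt2018_theorem2_of_theorem3_theorem5 (h3 : Literature.Combinatorics.Hypergraph.FGKMT2018_theorem3)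
    (h5 : FordGreenKonyaginMaynardTao2018_theorem5) : FordGreenKonyaginMaynardTao2018_theorem2 :=
  fgkmt2018_theorem2_of_theorem3_theorem4 h3 (fgkmt2018_theorem4_of_theorem5 h5)

/-- **FGKMT Theorem 1 from Theorems 3 and 5** (large gaps between primes,
`G(X) ≫ log X log₂ X log₄ X / log₃ X`).
[cite: FordGreenKonyaginMaynardTao2018, Thm 1 from Thm 3 + Thm 5 (§§3–6)] -/
theorem fgkmt2018_theorem1_of_theorem3_theorem5 (h3 : Literature.Combinatorics.Hypergraph.FGKMT2018_theorem3)
    (h5 : FordGreenKonyaginMaynardTao2018_theorem5) : FordGreenKonyaginMaynardTao2018_theorem1 :=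
  fgkmt2018_theorem1_of_theorem3_theorem4 h3 (fgkmt2018_theorem4_of_theorem5 h5)

/-- **Every Rankin constant from Theorems 3 and 5**: `RankinConstant κ` for all real `κ`.
[cite: FordGreenKonyaginMaynardTao2018, Thm 1 ⇒ Rankin's conjecture (§1)] -/
theorem rankinConstant_of_fgkmt2018_theorem3_theorem5 (h3 : Literature.Combinatorics.Hypergraph.FGKMT2018_theorem3)
    (h5 : FordGreenKonyaginMaynardTao2018_theorem5) (κ : ℝ) : RankinConstant κ :=
  rankinConstant_of_fgkmt2018_theorem3_theorem4 h3 (fgkmt2018_theorem4_of_theorem5 h5) κ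


end Literature.NumberTheory.Sieve
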